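import Literature.MathematicalPhysics.QuantumFieldTheory.Balaban1983to89.B4BoxCov237

/-!
# `Balaban1983to89.B4TwoBox120` — B4 (5.5) and (1.19)–(1.20) for NESTED NEUMANN BOXES `□ ⊂ □₀` at `A = 0`:
`|(Δ^{(j)}(□) − Δ^{(j)}(□₀))(y, y′)|` and `|δC_Λ^{(j)}(□, □₀; x, x′)| = |C_Λ^{(j)}(□; x, x′) − C_Λ^{(j)}(□₀; x, x′)|`
decay in `|x − x′| + dist(x, □₀^{(j)} ∖ □^{(j)}) + dist(x′, □₀^{(j)} ∖ □^{(j)})`, HYPOTHESIS-FREE, constants uniform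
in `j`, in both boxes, in `Λ` and in the window (a sibling of `B4BoxCov237`, whose HONEST SCOPE lists (1.19)–(1.20) as
not typed; no existing module is touched; nothing of B4 is asserted)

Source under audit (cell pub-balaban): T. Bałaban, *Regularity and decay of lattice Green's functions*, Commun. Math.
Phys. **89** (1983) 571–597 [`Balaban1983RegularityDecay`, "B4"], p. 574 [PDF 4] (1.19)–(1.20) and the last
paragraph of Sect. 1, p. 593 [PDF 23] (5.4), p. 594 [PDF 24] (5.5) and the Theorem (5.6), (5.9), (5.10) (journal
page = PDF page + 570; renders `b2b-balaban-ref1/pages/1983-cmp89-regularity-decay/1983-cmp89-regularity-decay-p004-x2.png`,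
`-p023-x2.png`, `-p024-x2.png`, read as images).

## WHAT IS PRINTED (verbatim; `≦`, `≧` of the print written `≤`, `≥`)

p. 574: «Finally, for Ω ⊂ Ω₀ and
δC_Λ^{(k)}(Ω, Ω₀, A) = C_Λ^{(k)}(Ω, A) − C_Λ^{(k)}(Ω₀, A),   (1.19)
we have
|δC_Λ^{(k)}(Ω, Ω₀, A; x, x′)| ≤ c₀ exp(−δ₀(|x−x′| + dist(x, Ω^{(k)c}) + dist(x′, Ω^{(k)c}))),  x, x′∈Λ.   (1.20)»
(the constants and `Λ` are those of «Proposition 2.3 of [1]. There exist positive constants δ₀, c₀, γ₀, γ₁ dependent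
on d and M only and such that for arbitrary Λ ⊂ Ω^{(k)} = Ω∩Z^d, Λ being a sum of big blocks and for e sufficiently
small, we have …», same page) … «The fifth section will be devoted to a general theorem concerning operators on the
unit lattice Z^d. There we have abstracted some basic features of our method and we have proven a theorem which, if
applied to operators (1.14), gives another proof of Proposition 2.3.»

p. 593: «Finally Corollary 2.3 implies that the considered operator is short-ranged in the sense that for some δ₀>0
|(Δ^{(k)}(Ω, A) + aL^{−2}P(A))(x, x′)| ≤ c₀e^{−δ₀|x−x′|},  x, x′∈Ω^{(k)},   (5.4)»

p. 594: «and a change of the domain Ω implies a change of the operator which can be estimated in the following way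
|(Δ^{(k)}(Ω, A) − Δ^{(k)}(Ω₀, A))(x, x′)| ≤ c₀e^{−δ₀(|x−x′|+dist(x, Ω^{(k)c})+dist(x′, Ω^{(k)c}))},  Ω ⊂ Ω₀,  x, x′∈Ω^{(k)}.   (5.5)
From these properties it follows that Proposition I.2.3 is a consequence of the following
Theorem. Let Ω ⊂ Z^d and let A be a symmetric operator defined on the space L²(Ω) of functions φ:Ω→R^N and satisfying
the following condition: there exist positive constants γ₀, c₀, δ₀ such that
A ≥ γ₀I,  |A(x, x′)| ≤ c₀e^{−δ₀|x−x′|},  x, x′∈Ω.   (5.6)»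
… «If we perturb the operator A by an operator B such that the condition (5.6) is satisfied for A + B, and
additionally B has the property
|B(x, x′)| ≤ c₀e^{−δ₀(|x−x′|+dist(x, Ω^c)+dist(x′, Ω^c))},  x, x′∈Ω,   (5.9)
then we have also
|A_Λ^{−1}(x, x′) − (A+B)_Λ^{−1}(x, x′)| ≤ c₁e^{−δ₁(|x−x′|+dist(x, Ω^c)+dist(x′, Ω^c))},  x, x′∈Λ.   (5.10)»

## WHAT THIS FILE CERTIFIES (kernel-checked, no hypotheses; the lineage is USED, not re-proved)

Setting: gauge field `A = 0` (`U ≡ 1`), dimension `d + 1`, `n ≥ 1` fine points per unit length (`n = L^j`,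
`ξ = 1/n`), window `a_j ∈ [a₋, a₊]` (`a₋ > 0`), `m_j² ∈ [0, m²₊]`; TWO NESTED BOXES: the outer unit box
`□₀^{(j)} = Π_μ[0, M₀_μ) ∩ ℤ^{d+1}` and the inner unit box `s + Π_μ[0, M_μ)`, `0 ≤ s_μ`, `s_μ + M_μ ≤ M₀_μ`
(`Fits M M₀ s`), `M_μ ≥ 1`; fine boxes `X = Π_μ[0, nM_μ)` (inner, in its own coordinates) and `X₀ = Π_μ[0, nM₀_μ)`,
related by the translation `τ : x ↦ x + n·s` (`emb (Fits.scale …)`), unit sites by `y ↦ y + s` (`emb`).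
* `boxOpR_mulVec_outer_sub_inner` (§2, exact algebra): the two Neumann box operators differ exactly by the bonds of
  `X₀` leaving `τX`: `(A(□₀)u)(τx) − (A(□)(u∘τ))(x) = n²·Σ_{w ∼ τx, w ∉ τX}(u(τx) − u(w))`,
  `A(·) = n²(−Δ^N) + m_j² + a_jQ_j^*Q_j` (`boxOpR` of `B4BoxCov237`); the mass term is diagonal and the block term
  sees whole blocks (`boxBlk_emb`).
* `green_inner_sub_outer` (§3): `G_j(□)(x, x′) − G_j(□₀)(τx, τx′) = Σ_z G_j(□)(x, z)·n²·Σ_{w ∼ τz, w ∉ τX}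
  (G_j(□₀)(τz, τx′) − G_j(□₀)(w, τx′))` — the second resolvent identity, supported on the boundary bonds.
* `keff55_twoBox` (§4) — **(5.5) for nested boxes**: there are `δ, c > 0` depending on `d` and the window only such
  that for all `n ≥ 1`, all nested pairs and all inner unit sites `y, y′`:
  `|Δ^{(j)}(□)(y, y′) − Δ^{(j)}(□₀)(y + s, y′ + s)| ≤ c·exp(−δ(|y − y′|_∞ + ω(y) + ω(y′)))`, where
  `Δ^{(j)}(□) = a_jI − a_j²Q_jG_j(□)Q_j^* = Keff n a_j m_j² M` and `ω = distOut` is the sup-distance from `y + s` to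
  `□₀^{(j)} ∖ (s + □^{(j)})`.  Proof (typist's, elementary): the identity `blockSum_diff_eq` — (5.5) as an exact
  formula: (block row of `G_j(□)` at a boundary point `z`) × `n²`·(block-row DIFFERENCE of `G_j(□₀)` across a boundary
  bond at `τz`) summed over the boundary bonds —, the lineage's hypothesis-free block-row decay and block-row
  derivative decay of the Neumann box Green function [(2.35): `B4Green242Bridge.greenBoxQ_decay_235_inv`,
  `greenBoxQ_deriv_decay_235_inv`, real forms `green_blockRow_bound`, `green_blockRowDiff_bound`], at most
  `2(d+1)·n^d` boundary points per `n`-block (`card_blk_bdry_le`) — the factor `n` of the derivative bound and the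
  `n^d` boundary points per block cancel the `n^{−(d+1)}` of `Q_j(·)Q_j^*` exactly, whence uniformity in `n` — and the
  lattice sum `rho_sumBound` (`B4Sect5Proof.latticeSum_le`).
* `cov120_twoBox_sub_delta` (§5) — **(1.19)–(1.20) for nested boxes**: with `L = ℓ + 1 ≥ 2`, boxes of unit side
  lengths `L·M′_μ` inside `L·M₀′_μ` shifted by `L·s′` (`Fits M′ M₀′ s′`; both boxes unions of `L`-blocks) and the window
  extended by `a ∈ [a₂₋, a₂₊]` (`a₂₋ > 0`): there are `δ, c > 0` such that for all `n ≥ 1`, all such nested pairs,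
  EVERY injection `e : m → □^{(j)}` (every `Λ ⊆ □^{(j)}`, `e` = the inclusion) and all `i, i′ : m`:
  `|C_Λ^{(j)}(□; eᵢ, eᵢ′) − C_{τΛ}^{(j)}(□₀; τeᵢ, τeᵢ′)| ≤ c·exp(−δ(|eᵢ − eᵢ′|_∞ + ω(eᵢ) + ω(eᵢ′)))`, with
  `C_Λ^{(j)}(□) = ((Δ^{(j)}(□) + aL^{−2}P)|_Λ)^{−1} = (covOpSub n ℓ a_j a m_j² M′ e)⁻¹` and
  `C_{τΛ}^{(j)}(□₀) = (covOpSub n ℓ a_j a m_j² M₀′ (τ ∘ e))⁻¹`; corollaries `cov120_twoBox_delta` (`Λ = □^{(j)}`),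
  `cov120_twoBox_finset_delta` (`Λ` a `Finset`) and an `example` at `d + 1 = 4`, `L = 2`.  Proof = THE PRINT'S ROUTE
  (p. 594): in the Sect. 5 Theorem take `Ω := □^{(j)}`, `A := (Δ^{(j)}(□₀) + aL^{−2}P)|_{τ□^{(j)}}` pulled back to
  `□^{(j)}` and `A + B := Δ^{(j)}(□) + aL^{−2}P`; the `P`-parts agree because `□` is a union of `L`-blocks
  (`blockAvgP_submatrix`, `covOp_submatrix`), so `B = Δ^{(j)}(□) − Δ^{(j)}(□₀)|_{τ□^{(j)}}` satisfies (5.9) with `ω`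
  by `keff55_twoBox` = (5.5); condition (5.6) for `A` and `A + B` is `B4BoxCov237.covOp_hyp56` (with
  `B4Sect5Torus.hyp56_submatrix` for the compression and the translation invariance `rho_emb`); the conclusion (5.10)
  is `B4Sect5Torus.perturb_bound` (kernel-proved in the lineage), giving `δ = rate(K, γ₀, c₁, δ₀)/4`, `c = bigC + 1`
  with `c₁ = c₀ + c_K + 1`, `δ₀ = min(κ, δ_K)` (`hyp56_weaken`).

## DICTIONARY (typist's; each line is a reading, not a quotation)

* `Ω ⊂ Ω₀` ↔ two rectangular parallelepipeds: `□₀^{(j)} = Π_μ[0, M₀_μ) ∩ ℤ^{d+1}` and `□^{(j)} = s + Π_μ[0, M_μ)`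
  with `Fits M M₀ s : ∀ μ, 0 ≤ s_μ ∧ s_μ + M_μ ≤ M₀_μ`; in §5 side lengths and shift are multiples of `L`
  (`Fits M′ M₀′ s′` scaled by `L`, «built of large blocks» typed as unions of `L`-blocks as in `B4BoxCov237`); the
  inner box carries its own coordinates and `emb : y ↦ y + s` (fine points `x ↦ x + n·s`, `Fits.scale`) is the
  inclusion `□^{(j)} ⊂ □₀^{(j)}` (`X ⊂ X₀`).
* `G_j(□) = (boxOpR …)⁻¹`, `Q_j`, `Δ^{(j)}(□) = Keff`, `P = blockAvgP`, `C^{(j)}(□) = (covOp …)⁻¹`,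
  `X|_Λ = covOpSub … e`, `|y − y′| = supNorm (y − y′)`: exactly as in `B4BoxCov237` (its DICTIONARY);
  `C_Λ^{(k)}(Ω₀, A)` for `Λ ⊂ Ω^{(k)} ⊂ Ω₀^{(k)}` ↔ `(covOpSub … M₀′ (emb ∘ e))⁻¹` (the outer operator compressed to
  the translated `Λ`); `δC_Λ^{(k)}(Ω, Ω₀; x, x′)` (1.19) ↔ `(covOpSub … M′ e)⁻¹ i i′ − (covOpSub … M₀′ (emb ∘ e))⁻¹ i i′`.
* `dist(x, Ω^{(k)c})` in (1.20)/(5.5) ↔ `distOut hs y = inf{|y + s − v|_∞ : v ∈ □₀^{(j)}, v − s ∉ □^{(j)}}`, the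
  sup-distance to the complement of the inner unit box INSIDE the outer unit box (`= sInf ∅ = 0` if `□ = □₀`).
  Since `□₀^{(j)} ∖ □^{(j)} ⊆ Ω^{(k)c}`, `distOut ≥ dist_∞(·, Ω^{(k)c})`, so each certified bound implies the same
  bound with the printed `dist(·, Ω^{(k)c})` in the sup-norm reading.
* the bonds of `Ω₀` crossing `∂Ω` ↔ `extNbrs n hs z` = the `X₀`-neighbours `w` of `τz` with `w − n·s ∉ X`.

## HONEST SCOPE (what is NOT certified)

* `A = 0` only; `Ω ⊂ Ω₀` rectangular parallelepipeds only (Neumann boxes, half-open `Π[0, nM_μ)` on the fine lattice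
  as in the lineage's typing of (2.42)), not general regions; the inner box is placed by an integer shift of unit
  sites (§4) / of `L`-blocks (§5); (5.4) is not re-typed (it is `B4BoxCov237.covOp_hyp56`/`Keff_entry_bound`).
* `Ω^{(k)c}` is READ as `□₀^{(j)} ∖ □^{(j)}` (DICTIONARY; the certified statements are the stronger ones); distances
  are sup-norm; only EXISTENCE of the constants is printed and certified — they are not the print's `c₀, δ₀` of
  Proposition 2.3 (the print uses one pair throughout), they depend on `d` (§4) resp. `d`, `ℓ` (§5) and the window,
  and nothing is claimed about their size or about uniformity in `L`.
* In §5 `Λ` is an ARBITRARY subset of `□^{(j)}` (the range of an injection) — more than «Λ being a sum of big blocks»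
  asks, harmless at `A = 0` and NOT claimed for `A ≠ 0`.
* The proof of (5.5) is the typist's (boundary-bond resolvent identity + (2.35)); the paper states (5.5) at p. 594
  without proof at that point («… which can be estimated in the following way»); the route (5.5) + (5.6) + Theorem
  (5.10) ⇒ (1.20) IS the print's («From these properties it follows that Proposition I.2.3 is a consequence of the
  following Theorem»), with the Theorem kernel-proved in `B4Sect5Torus`.
* Nothing is inferred from the manuscript: every step is kernel-checked from the definitions; the quoted sentences
  locate the statements, they are not used as hypotheses.

Value = kernel certificate of an elementary reading of (5.5) and (1.19)–(1.20) for nested Neumann boxes at `A = 0`;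
NOT summit progress.
-/

namespace Literature.MathematicalPhysics.QuantumFieldTheory.Balaban1983to89.B4TwoBox120

open Finset Matrix
open Literature.MathematicalPhysics.QuantumFieldTheory.Balaban1983to89.B4ContourShift
open Literature.MathematicalPhysics.QuantumFieldTheory.Balaban1983to89.B4Reflection242
open Literature.MathematicalPhysics.QuantumFieldTheory.Balaban1983to89.B4Green242Bridge
open Literature.MathematicalPhysics.QuantumFieldTheory.Balaban1983to89.B4BoxCov237
open B4Sect5Torus (IsPseudoDist SumBound Hyp56 Hyp59 rate rate_pos bigC bigC_nonneg hyp56_submatrix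
  perturb_bound)
open B4Sect5Proof (latticeConst latticeConst_nonneg latticeSum_le)

noncomputable section

variable {d : ℕ}

/-! ## §1 Nested boxes: the inner box `Π_μ[s_μ, s_μ + N_μ)` inside the outer box `Π_μ[0, N₀_μ)` -/

/-- `Fits N N₀ s`: the translated box `s + Π_μ[0, N_μ)` lies inside `Π_μ[0, N₀_μ)`, i.e. `0 ≤ s_μ` and
`s_μ + N_μ ≤ N₀_μ` in every direction (`Ω ⊂ Ω₀` for two boxes). [folklore] -/
def Fits (N N0 : Fin (d + 1) → ℕ) (s : Fin (d + 1) → ℤ) : Prop := ∀ i, 0 ≤ s i ∧ s i + N i ≤ N0 i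

/-- scaling a nested pair of boxes by `n` points per unit length: `n·s + Π[0, n·N) ⊂ Π[0, n·N₀)`. [folklore] -/
theorem Fits.scale {N N0 : Fin (d + 1) → ℕ} {s : Fin (d + 1) → ℤ} (h : Fits N N0 s) (n : ℕ) :
    Fits (fun i => n * N i) (fun i => n * N0 i) (fun i => (n : ℤ) * s i) := by
  intro i
  obtain ⟨h0, h1⟩ := h i
  have hn : (0 : ℤ) ≤ n := by positivity
  refine ⟨by positivity, ?_⟩
  push_cast
  nlinarith

/-- the outer box of a nested pair with `N_μ ≥ 1` has `N₀_μ ≥ 1`. [folklore] -/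
theorem Fits.one_le {N N0 : Fin (d + 1) → ℕ} {s : Fin (d + 1) → ℤ} (h : Fits N N0 s) (hN : ∀ i, 1 ≤ N i)
    (i : Fin (d + 1)) : 1 ≤ N0 i := by
  obtain ⟨h0, h1⟩ := h i
  have h2 : (1 : ℤ) ≤ N i := by exact_mod_cast hN i
  have h3 : (1 : ℤ) ≤ N0 i := by linarith
  exact_mod_cast h3

/-- a point of the inner box, translated by `s`, is a point of the outer box. [folklore] -/
theorem add_mem_boxDom {N N0 : Fin (d + 1) → ℕ} {s : Fin (d + 1) → ℤ} (h : Fits N N0 s)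
    {x : Fin (d + 1) → ℤ} (hx : x ∈ boxDom N) : x + s ∈ boxDom N0 := by
  rw [mem_boxDom] at hx ⊢
  intro i
  obtain ⟨h0, h1⟩ := h i
  obtain ⟨hx0, hx1⟩ := hx i
  simp only [Pi.add_apply]
  constructor <;> linarith

/-- the embedding `x ↦ x + s` of the inner box into the outer box (`Ω^{(k)} ⊂ Ω₀^{(k)}` on unit sites,
`Ω ⊂ Ω₀` on fine points). [folklore] -/
def emb {N N0 : Fin (d + 1) → ℕ} {s : Fin (d + 1) → ℤ} (h : Fits N N0 s) (x : ↥(boxDom N)) : ↥(boxDom N0) :=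
  ⟨x.1 + s, add_mem_boxDom h x.2⟩

/-- the coordinates of a translated point. [folklore] -/
@[simp] theorem emb_val {N N0 : Fin (d + 1) → ℕ} {s : Fin (d + 1) → ℤ} (h : Fits N N0 s) (x : ↥(boxDom N)) :
    (emb h x).1 = x.1 + s := rfl

/-- the embedding is injective. [folklore] -/
theorem emb_injective {N N0 : Fin (d + 1) → ℕ} {s : Fin (d + 1) → ℤ} (h : Fits N N0 s) :
    Function.Injective (emb h) := by
  intro x y hxy
  apply Subtype.ext
  have h1 := congrArg Subtype.val hxy
  simp only [emb_val] at h1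
  exact add_right_cancel h1

/-- a point of the outer box is a translated inner point iff its back-translate lies in the inner box. [folklore] -/
theorem exists_emb_eq_iff {N N0 : Fin (d + 1) → ℕ} {s : Fin (d + 1) → ℤ} (h : Fits N N0 s) (w : ↥(boxDom N0)) :
    (∃ x, emb h x = w) ↔ w.1 - s ∈ boxDom N := by
  constructor
  · rintro ⟨x, rfl⟩
    simp
  · intro hw
    exact ⟨⟨w.1 - s, hw⟩, Subtype.ext (by simp)⟩

/-- block labels translate: `blk n (x + n·s) = blk n x + s`. [folklore] -/
theorem blk_add_mul {n : ℕ} (hn : 1 ≤ n) (x s : Fin (d + 1) → ℤ) :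
    blk n (x + fun i => (n : ℤ) * s i) = blk n x + s := by
  funext i
  have hn0 : (n : ℤ) ≠ 0 := by exact_mod_cast (show n ≠ 0 by omega)
  simp only [blk, Pi.add_apply]
  rw [Int.add_mul_ediv_left _ _ hn0]

/-- an outer fine point whose block label is the translate of an inner unit site is the translate of an inner
fine point. [folklore] -/
theorem sub_mem_boxDom_of_blk {n : ℕ} (hn : 1 ≤ n) {M : Fin (d + 1) → ℕ} {s : Fin (d + 1) → ℤ}
    {w : Fin (d + 1) → ℤ} (hw : blk n w - s ∈ boxDom M) :
    (w - fun i => (n : ℤ) * s i) ∈ boxDom (fun i => n * M i) := by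
  rw [mem_boxDom] at hw ⊢
  intro i
  obtain ⟨h0, h1⟩ := hw i
  simp only [blk, Pi.sub_apply] at h0 h1 ⊢
  have hn' : (0 : ℤ) < n := by exact_mod_cast hn
  have e1 : w i / n * n ≤ w i := Int.ediv_mul_le _ hn'.ne'
  have e2 : w i < (w i / n + 1) * n := Int.lt_ediv_add_one_mul_self _ hn'
  push_cast at h1 ⊢
  have h1' : w i / n + 1 ≤ s i + M i := by linarith
  constructor <;> nlinarith

/-- **block sums of the outer box over a translated inner block are block sums of the inner box**:
`Σ_{w ∈ X₀, blk w = y + s} g(w) = Σ_{x ∈ X, blk x = y} g(x + n·s)` for an inner unit site `y`. [folklore] -/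
theorem sum_blk_outer_eq {n : ℕ} (hn : 1 ≤ n) {M M0 : Fin (d + 1) → ℕ} {s : Fin (d + 1) → ℤ}
    (hs : Fits M M0 s) (g : ↥(boxDom (fun i => n * M0 i)) → ℝ) {y : Fin (d + 1) → ℤ} (hy : y ∈ boxDom M) :
    (∑ w : ↥(boxDom (fun i => n * M0 i)), if blk n w.1 = y + s then g w else 0)
      = ∑ x : ↥(boxDom (fun i => n * M i)), if blk n x.1 = y then g (emb (hs.scale n) x) else 0 := by
  rw [B4Sect5Torus.sum_eq_sum_range (emb_injective (hs.scale n))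
    (fun w => if blk n w.1 = y + s then g w else 0) ?_]
  · refine Finset.sum_congr rfl fun x _ => ?_
    have hb : blk n (emb (hs.scale n) x).1 = blk n x.1 + s := by
      rw [emb_val]
      exact blk_add_mul hn x.1 s
    simp only [hb]
    by_cases hx : blk n x.1 = y
    · rw [if_pos (by rw [hx]), if_pos hx]
    · rw [if_neg (fun h => hx (add_right_cancel h)), if_neg hx]
  · intro w hw
    rw [if_neg]
    intro hb
    apply hw
    rw [exists_emb_eq_iff]
    apply sub_mem_boxDom_of_blk hn
    rw [hb, add_sub_cancel_right]
    exact hy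

/-- the same in `Finset.filter` form. [folklore] -/
theorem sum_filter_blk_outer_eq {n : ℕ} (hn : 1 ≤ n) {M M0 : Fin (d + 1) → ℕ} {s : Fin (d + 1) → ℤ}
    (hs : Fits M M0 s) (g : ↥(boxDom (fun i => n * M0 i)) → ℝ) {y : Fin (d + 1) → ℤ} (hy : y ∈ boxDom M) :
    ∑ w ∈ Finset.univ.filter (fun w : ↥(boxDom (fun i => n * M0 i)) => blk n w.1 = y + s), g w
      = ∑ x ∈ Finset.univ.filter (fun x : ↥(boxDom (fun i => n * M i)) => blk n x.1 = y),
          g (emb (hs.scale n) x) := by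
  rw [Finset.sum_filter, Finset.sum_filter]
  exact sum_blk_outer_eq hn hs g hy

/-! ## §2 The Neumann boundary identity: the two box operators differ by the bonds of `□₀` leaving `□` -/

/-- the neighbour relation is translation invariant. [folklore] -/
theorem mem_nbrs_add_iff (x z s : Fin (d + 1) → ℤ) : z ∈ nbrs (x + s) ↔ z - s ∈ nbrs x := by
  rw [mem_nbrs_iff_sub, mem_nbrs_iff_sub]
  have h : z - (x + s) = z - s - x := by abel
  rw [h]

/-- the OUTER NEIGHBOURS ACROSS THE BOUNDARY of the inner box at an inner fine point `x`: the points of the outer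
fine box adjacent to `x + n·s` that are not translates of inner points — the bonds of `□₀` leaving `□` at `x`.
[folklore] -/
def extNbrs (n : ℕ) {M M0 : Fin (d + 1) → ℕ} {s : Fin (d + 1) → ℤ} (hs : Fits M M0 s)
    (x : ↥(boxDom (fun i => n * M i))) : Finset ↥(boxDom (fun i => n * M0 i)) :=
  (boxNbrs (fun i => n * M0 i) (emb (hs.scale n) x)).filter
    fun w => (w.1 - fun i => (n : ℤ) * s i) ∉ boxDom (fun i => n * M i)

/-- membership in the boundary-neighbour set. [folklore] -/
theorem mem_extNbrs {n : ℕ} {M M0 : Fin (d + 1) → ℕ} {s : Fin (d + 1) → ℤ} (hs : Fits M M0 s)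
    {x : ↥(boxDom (fun i => n * M i))} {w : ↥(boxDom (fun i => n * M0 i))} :
    w ∈ extNbrs n hs x ↔
      w.1 ∈ nbrs (emb (hs.scale n) x).1 ∧ (w.1 - fun i => (n : ℤ) * s i) ∉ boxDom (fun i => n * M i) := by
  unfold extNbrs boxNbrs
  simp only [Finset.mem_filter, Finset.mem_univ, true_and]

/-- there are at most `2(d+1)` boundary neighbours at a point. [folklore] -/
theorem card_extNbrs_le {n : ℕ} {M M0 : Fin (d + 1) → ℕ} {s : Fin (d + 1) → ℤ} (hs : Fits M M0 s)
    (x : ↥(boxDom (fun i => n * M i))) : (extNbrs n hs x).card ≤ 2 * (d + 1) := by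
  unfold extNbrs
  refine (Finset.card_filter_le _ _).trans ?_
  rw [card_boxNbrs, ← card_nbrs (emb (hs.scale n) x).1]
  exact Finset.card_filter_le _ _

/-- the outer neighbours of a translated inner point which ARE translates of inner points are exactly the
translates of its inner neighbours. [folklore] -/
theorem filter_boxNbrs_range {n : ℕ} {M M0 : Fin (d + 1) → ℕ} {s : Fin (d + 1) → ℤ} (hs : Fits M M0 s)
    (x : ↥(boxDom (fun i => n * M i))) :
    (boxNbrs (fun i => n * M0 i) (emb (hs.scale n) x)).filter
        (fun w => (w.1 - fun i => (n : ℤ) * s i) ∈ boxDom (fun i => n * M i))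
      = (boxNbrs (fun i => n * M i) x).map ⟨emb (hs.scale n), emb_injective _⟩ := by
  ext w
  unfold boxNbrs
  simp only [Finset.mem_filter, Finset.mem_map, Function.Embedding.coeFn_mk, Finset.mem_univ, true_and]
  constructor
  · rintro ⟨hw, hmem⟩
    refine ⟨⟨w.1 - fun i => (n : ℤ) * s i, hmem⟩, ?_, Subtype.ext (by simp)⟩
    rw [emb_val, mem_nbrs_add_iff] at hw
    exact hw
  · rintro ⟨z, hz, rfl⟩
    refine ⟨?_, ?_⟩
    · rw [emb_val, emb_val, mem_nbrs_add_iff, add_sub_cancel_right]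
      exact hz
    · simp

/-- the outer block of a translated inner point is the translate of its inner block (the inner box is a union of
whole blocks of the outer box). [folklore] -/
theorem boxBlk_emb {n : ℕ} (hn : 1 ≤ n) {M M0 : Fin (d + 1) → ℕ} {s : Fin (d + 1) → ℤ} (hs : Fits M M0 s)
    (x : ↥(boxDom (fun i => n * M i))) :
    boxBlk n (fun i => n * M0 i) (emb (hs.scale n) x)
      = (boxBlk n (fun i => n * M i) x).map ⟨emb (hs.scale n), emb_injective _⟩ := by
  ext w
  unfold boxBlk
  simp only [Finset.mem_filter, Finset.mem_univ, true_and, Finset.mem_map, Function.Embedding.coeFn_mk]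
  rw [emb_val, blk_add_mul hn]
  constructor
  · intro hw
    have hmem : (w.1 - fun i => (n : ℤ) * s i) ∈ boxDom (fun i => n * M i) := by
      apply sub_mem_boxDom_of_blk hn
      rw [hw, add_sub_cancel_right]
      exact blk_mem_boxDom hn x.2
    refine ⟨⟨w.1 - fun i => (n : ℤ) * s i, hmem⟩, ?_, Subtype.ext (by simp)⟩
    have h1 := blk_add_mul hn (w.1 - fun i => (n : ℤ) * s i) s
    rw [sub_add_cancel, hw] at h1
    exact (add_right_cancel h1).symm
  · rintro ⟨z, hz, rfl⟩
    rw [emb_val, blk_add_mul hn, hz]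

/-- **THE NEUMANN BOUNDARY IDENTITY.**  For a function `u` on the outer fine box and an inner fine point `x`,
`(A(□₀)u)(x + ns) − (A(□)(u∘τ_s))(x) = n²·Σ_{w ∈ ∂-nbrs(x)}(u(x + ns) − u(w))`, `A(·) = n²(−Δ^N) + m² +
(a/n^{d+1})1_{same block}` (`boxOpR`): the two Neumann operators differ exactly by the bonds of `□₀` crossing the
boundary of `□` (the mass term is diagonal and the block term sees whole blocks). [folklore] -/
theorem boxOpR_mulVec_outer_sub_inner {n : ℕ} (hn : 1 ≤ n) (a m2 : ℝ) {M M0 : Fin (d + 1) → ℕ}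
    {s : Fin (d + 1) → ℤ} (hs : Fits M M0 s) (u : ↥(boxDom (fun i => n * M0 i)) → ℝ)
    (x : ↥(boxDom (fun i => n * M i))) :
    (boxOpR n a m2 M0).mulVec u (emb (hs.scale n) x)
        - (boxOpR n a m2 M).mulVec (fun z => u (emb (hs.scale n) z)) x
      = (n : ℝ) ^ 2 * ∑ w ∈ extNbrs n hs x, (u (emb (hs.scale n) x) - u w) := by
  unfold boxOpR
  rw [opBoxR_mulVec, opBoxR_mulVec]
  have hB : ∑ w ∈ boxBlk n (fun i => n * M0 i) (emb (hs.scale n) x), u w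
      = ∑ z ∈ boxBlk n (fun i => n * M i) x, u (emb (hs.scale n) z) := by
    rw [boxBlk_emb hn hs x, Finset.sum_map]
    rfl
  have hN : ∑ w ∈ boxNbrs (fun i => n * M0 i) (emb (hs.scale n) x), (u (emb (hs.scale n) x) - u w)
      = ∑ z ∈ boxNbrs (fun i => n * M i) x, (u (emb (hs.scale n) x) - u (emb (hs.scale n) z))
        + ∑ w ∈ extNbrs n hs x, (u (emb (hs.scale n) x) - u w) := by
    rw [← Finset.sum_filter_add_sum_filter_not (boxNbrs _ (emb (hs.scale n) x))
      (fun w => (w.1 - fun i => (n : ℤ) * s i) ∈ boxDom (fun i => n * M i)), filter_boxNbrs_range hs x,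
      Finset.sum_map]
    rfl
  rw [hB, hN]
  ring

/-! ## §3 The two Green functions compared (second resolvent identity across the boundary of `□`) -/

/-- applying a matrix to a column of another matrix: `(A·G(·,c))(r) = (A G)(r,c)`. [folklore] -/
theorem mulVec_col {ι : Type*} [Fintype ι] (A G : Matrix ι ι ℝ) (r c : ι) :
    A.mulVec (fun j => G j c) r = (A * G) r c := by
  simp [Matrix.mulVec, dotProduct, Matrix.mul_apply]

/-- **THE TWO NEUMANN GREEN FUNCTIONS COMPARED.**  With `G = A(□)⁻¹`, `G₀ = A(□₀)⁻¹` (`boxOpR`) and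
`τ = emb` the translation of the inner fine box into the outer one,
`G(x,x′) − G₀(τx, τx′) = Σ_{z ∈ X} G(x,z)·n²·Σ_{w ∈ ∂-nbrs(z)}(G₀(τz, τx′) − G₀(w, τx′))`:
the difference of the two Green functions is supported, as a source, on the bonds of `□₀` crossing `∂□`
(apply `G` to the Neumann boundary identity for `u = G₀(·, τx′)`). [folklore] -/
theorem green_inner_sub_outer {n : ℕ} (hn : 1 ≤ n) {a m2 : ℝ} (ha : 0 < a) (hm : 0 ≤ m2)
    {M M0 : Fin (d + 1) → ℕ} (hM : ∀ i, 1 ≤ M i) (hM0 : ∀ i, 1 ≤ M0 i) {s : Fin (d + 1) → ℤ}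
    (hs : Fits M M0 s) (x x' : ↥(boxDom (fun i => n * M i))) :
    (boxOpR n a m2 M)⁻¹ x x' - (boxOpR n a m2 M0)⁻¹ (emb (hs.scale n) x) (emb (hs.scale n) x')
      = ∑ z, (boxOpR n a m2 M)⁻¹ x z * ((n : ℝ) ^ 2 * ∑ w ∈ extNbrs n hs z,
          ((boxOpR n a m2 M0)⁻¹ (emb (hs.scale n) z) (emb (hs.scale n) x')
            - (boxOpR n a m2 M0)⁻¹ w (emb (hs.scale n) x'))) := by
  -- the column `u = G₀(·, τx′)` of the outer Green function and its pull-back `v = u ∘ τ`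
  have h0 : ∀ w, (boxOpR n a m2 M0).mulVec
      (fun j => (boxOpR n a m2 M0)⁻¹ j (emb (hs.scale n) x')) w
        = if w = emb (hs.scale n) x' then 1 else 0 := by
    intro w
    rw [mulVec_col, boxOpR_mul_inv hn ha hm hM0, Matrix.one_apply]
  -- `A(□)v = δ_{x′} − T` with `T` the boundary source
  have h1 : ∀ z, (boxOpR n a m2 M).mulVec
      (fun z => (boxOpR n a m2 M0)⁻¹ (emb (hs.scale n) z) (emb (hs.scale n) x')) z
        = (if z = x' then 1 else 0) - (n : ℝ) ^ 2 * ∑ w ∈ extNbrs n hs z,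
          ((boxOpR n a m2 M0)⁻¹ (emb (hs.scale n) z) (emb (hs.scale n) x')
            - (boxOpR n a m2 M0)⁻¹ w (emb (hs.scale n) x')) := by
    intro z
    have h := boxOpR_mulVec_outer_sub_inner hn a m2 hs
      (fun j => (boxOpR n a m2 M0)⁻¹ j (emb (hs.scale n) x')) z
    rw [h0] at h
    simp only [(emb_injective (hs.scale n)).eq_iff] at h
    linarith
  -- `v = G·(A(□)v)`
  have hGA : (boxOpR n a m2 M)⁻¹ * boxOpR n a m2 M = 1 := boxOpR_inv_mul hn ha hm hM
  have h2 : (fun z => (boxOpR n a m2 M0)⁻¹ (emb (hs.scale n) z) (emb (hs.scale n) x'))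
      = ((boxOpR n a m2 M)⁻¹).mulVec ((boxOpR n a m2 M).mulVec
          (fun z => (boxOpR n a m2 M0)⁻¹ (emb (hs.scale n) z) (emb (hs.scale n) x'))) := by
    rw [Matrix.mulVec_mulVec, hGA, Matrix.one_mulVec]
  have h3 := congrFun h2 x
  simp only [Matrix.mulVec, dotProduct] at h3
  -- `h3 : G₀(τx,τx′) = Σ_z G(x,z)·(A(□)v)(z)`; substitute `h1`
  have h4 : (boxOpR n a m2 M0)⁻¹ (emb (hs.scale n) x) (emb (hs.scale n) x')
      = ∑ z, (boxOpR n a m2 M)⁻¹ x z * ((if z = x' then 1 else 0) - (n : ℝ) ^ 2 *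
          ∑ w ∈ extNbrs n hs z, ((boxOpR n a m2 M0)⁻¹ (emb (hs.scale n) z) (emb (hs.scale n) x')
            - (boxOpR n a m2 M0)⁻¹ w (emb (hs.scale n) x'))) := by
    rw [h3]
    refine Finset.sum_congr rfl fun z _ => ?_
    have h1z := h1 z
    simp only [Matrix.mulVec, dotProduct] at h1z
    rw [h1z]
  rw [h4]
  simp only [mul_sub, Finset.sum_sub_distrib, mul_ite, mul_one, mul_zero, Finset.sum_ite_eq',
    Finset.mem_univ, if_true]
  ring

/-! ## §4 The block-integrated Green functions of the two boxes: (5.5) for `Δ^{(j)}(□) − Δ^{(j)}(□₀)` -/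

/-! ### §4a The two inputs in real form: block-row decay and block-row derivative decay of `G(□)` -/

/-- real form of the complex block-row derivative. [folklore] -/
theorem blockRowDiff_real {n : ℕ} (hn : 1 ≤ n) {a m2 : ℝ} (ha : 0 < a) (hm : 0 ≤ m2) {M : Fin (d + 1) → ℕ}
    (hM : ∀ i, 1 ≤ M i) (x xe : ↥(boxDom (fun i => n * M i))) (y : Fin (d + 1) → ℤ) :
    ((n : ℂ) * ∑ x' : ↥(boxDom (fun i => n * M i)),
        (if blk n x'.1 = y then (boxOp n a m2 M)⁻¹ xe x' - (boxOp n a m2 M)⁻¹ x x' else 0))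
      = (((n : ℝ) * ∑ x' : ↥(boxDom (fun i => n * M i)),
          (if blk n x'.1 = y then (boxOpR n a m2 M)⁻¹ xe x' - (boxOpR n a m2 M)⁻¹ x x' else 0) : ℝ) : ℂ) := by
  rw [boxOp_inv_eq_map hn ha hm hM]
  push_cast
  congr 1
  refine Finset.sum_congr rfl fun x' _ => ?_
  split_ifs
  · simp [Matrix.map_apply]
  · simp

/-- **BLOCK-ROW DECAY of the Neumann box Green function, real form** [B4 (2.35), from `B4BoxCov237`]:
`|Σ_{x′ ∈ B(y)} G(□)(x, x′)| ≤ C e^{−κ|blk x − y|}` uniformly in `n`, the box and the window.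
[cite: Balaban1983RegularityDecay, p.582 (2.35); kernel-proved in `B4Green242Bridge`] -/
theorem green_blockRow_bound (d : ℕ) (aminus aplus m2plus : ℝ) (ha : 0 < aminus) :
    ∃ κ C : ℝ, 0 < κ ∧ 0 ≤ C ∧ ∀ (n : ℕ), 1 ≤ n → ∀ (a m2 : ℝ), aminus ≤ a → a ≤ aplus → 0 ≤ m2 → m2 ≤ m2plus →
      ∀ (M : Fin (d + 1) → ℕ), (∀ i, 1 ≤ M i) →
        ∀ (x : ↥(boxDom (fun i => n * M i))) (y : Fin (d + 1) → ℤ), y ∈ boxDom M →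
          |∑ x' : ↥(boxDom (fun i => n * M i)), (if blk n x'.1 = y then (boxOpR n a m2 M)⁻¹ x x' else 0)|
            ≤ C * Real.exp (-(κ * supNorm (blk n x.1 - y))) := by
  obtain ⟨κ, C, hκ, hC, h⟩ := greenBoxQ_decay_235_inv d aminus aplus m2plus ha
  refine ⟨κ, C, hκ, hC, fun n hn a m2 h1 h2 h3 h4 M hM x y hy => ?_⟩
  have hb := (h n hn a m2 h1 h2 h3 h4 M hM).2 x y hy
  rw [blockRowSum_real hn (lt_of_lt_of_le ha h1) h3 hM, Complex.norm_real, Real.norm_eq_abs] at hb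
  exact hb

/-- **BLOCK-ROW DERIVATIVE DECAY of the Neumann box Green function, real form** [B4 (2.35) derivative part, from
`B4BoxCov237`]: `|n·Σ_{x′ ∈ B(y)}(G(□)(x + e_μ, x′) − G(□)(x, x′))| ≤ C e^{−κ|blk x − y|}` uniformly.
[cite: Balaban1983RegularityDecay, p.582 (2.35); kernel-proved in `B4Green242Bridge`] -/
theorem green_blockRowDiff_bound (d : ℕ) (aminus aplus m2plus : ℝ) (ha : 0 < aminus) :
    ∃ κ C : ℝ, 0 < κ ∧ 0 ≤ C ∧ ∀ (n : ℕ), 1 ≤ n → ∀ (a m2 : ℝ), aminus ≤ a → a ≤ aplus → 0 ≤ m2 → m2 ≤ m2plus →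
      ∀ (M : Fin (d + 1) → ℕ), (∀ i, 1 ≤ M i) →
        ∀ (μ : Fin (d + 1)) (x xe : ↥(boxDom (fun i => n * M i))), xe.1 = x.1 + Pi.single μ 1 →
          ∀ (y : Fin (d + 1) → ℤ), y ∈ boxDom M →
            |(n : ℝ) * ∑ x' : ↥(boxDom (fun i => n * M i)),
                (if blk n x'.1 = y then (boxOpR n a m2 M)⁻¹ xe x' - (boxOpR n a m2 M)⁻¹ x x' else 0)|
              ≤ C * Real.exp (-(κ * supNorm (blk n x.1 - y))) := by
  obtain ⟨κ, C, hκ, hC, h⟩ := greenBoxQ_deriv_decay_235_inv d aminus aplus m2plus ha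
  refine ⟨κ, C, hκ, hC, fun n hn a m2 h1 h2 h3 h4 M hM μ x xe hxe y hy => ?_⟩
  have hb := (h n hn a m2 h1 h2 h3 h4 M hM).2 μ x xe hxe y hy
  rw [blockRowDiff_real hn (lt_of_lt_of_le ha h1) h3 hM, Complex.norm_real, Real.norm_eq_abs] at hb
  exact hb

/-! ### §4b Geometry of the boundary bonds -/

/-- a boundary neighbour `w` of `τz` is `τz ± e_μ`. [folklore] -/
theorem extNbrs_step {n : ℕ} {M M0 : Fin (d + 1) → ℕ} {s : Fin (d + 1) → ℤ} (hs : Fits M M0 s)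
    {z : ↥(boxDom (fun i => n * M i))} {w : ↥(boxDom (fun i => n * M0 i))} (hw : w ∈ extNbrs n hs z) :
    ∃ μ, w.1 = (emb (hs.scale n) z).1 + Pi.single μ 1 ∨ w.1 = (emb (hs.scale n) z).1 - Pi.single μ 1 :=
  mem_nbrs.1 ((mem_extNbrs hs).1 hw).1

/-- the block of a boundary neighbour is within sup-distance `1` of the block of the point. [folklore] -/
theorem extNbrs_blk_le {n : ℕ} (hn : 1 ≤ n) {M M0 : Fin (d + 1) → ℕ} {s : Fin (d + 1) → ℤ} (hs : Fits M M0 s)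
    {z : ↥(boxDom (fun i => n * M i))} {w : ↥(boxDom (fun i => n * M0 i))} (hw : w ∈ extNbrs n hs z) :
    supNorm (blk n (emb (hs.scale n) z).1 - blk n w.1) ≤ 1 := by
  obtain ⟨μ, h | h⟩ := extNbrs_step hs hw
  · have h1 := supNorm_coarse_add_e_sub_le n hn (emb (hs.scale n) z).1 μ
    rw [B4Green244.e, ← h] at h1
    rw [← B4TorusKernel.supNorm_neg, neg_sub]
    exact h1
  · have h1 := supNorm_coarse_add_e_sub_le n hn w.1 μ
    have h' : (emb (hs.scale n) z).1 = w.1 + Pi.single μ 1 := by rw [h, sub_add_cancel]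
    rw [B4Green244.e, ← h'] at h1
    exact h1

/-- the unit block of a boundary neighbour lies outside the inner unit box. [folklore] -/
theorem extNbrs_blk_not_mem {n : ℕ} (hn : 1 ≤ n) {M M0 : Fin (d + 1) → ℕ} {s : Fin (d + 1) → ℤ}
    (hs : Fits M M0 s) {z : ↥(boxDom (fun i => n * M i))} {w : ↥(boxDom (fun i => n * M0 i))}
    (hw : w ∈ extNbrs n hs z) : blk n w.1 - s ∉ boxDom M :=
  fun h => ((mem_extNbrs hs).1 hw).2 (sub_mem_boxDom_of_blk hn h)

/-- a fine point off the faces of its box keeps all its `2(d+1)` lattice neighbours inside the box. [folklore] -/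
theorem add_single_mem_of_not_face {n : ℕ} {M : Fin (d + 1) → ℕ} {z : Fin (d + 1) → ℤ}
    (hz : z ∈ boxDom (fun i => n * M i)) (hface : ∀ μ, z μ ≠ 0 ∧ z μ + 1 ≠ n * M μ) (μ : Fin (d + 1)) :
    z + Pi.single μ 1 ∈ boxDom (fun i => n * M i) ∧ z - Pi.single μ 1 ∈ boxDom (fun i => n * M i) := by
  rw [mem_boxDom] at hz
  rw [mem_boxDom, mem_boxDom]
  refine ⟨fun i => ?_, fun i => ?_⟩
  · obtain ⟨h0, h1⟩ := hz i
    obtain ⟨hf0, hf1⟩ := hface i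
    push_cast at h1 hf1 ⊢
    by_cases hi : i = μ
    · subst hi
      simp only [Pi.add_apply, Pi.single_eq_same]
      constructor <;> omega
    · simp only [Pi.add_apply, Pi.single_eq_of_ne hi, add_zero]
      exact ⟨h0, h1⟩
  · obtain ⟨h0, h1⟩ := hz i
    obtain ⟨hf0, hf1⟩ := hface i
    push_cast at h1 hf1 ⊢
    by_cases hi : i = μ
    · subst hi
      simp only [Pi.sub_apply, Pi.single_eq_same]
      constructor <;> omega
    · simp only [Pi.sub_apply, Pi.single_eq_of_ne hi, sub_zero]
      exact ⟨h0, h1⟩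

/-- a point with a boundary bond lies on a face of the inner fine box. [folklore] -/
theorem extNbrs_face {n : ℕ} {M M0 : Fin (d + 1) → ℕ} {s : Fin (d + 1) → ℤ} (hs : Fits M M0 s)
    {z : ↥(boxDom (fun i => n * M i))} {w : ↥(boxDom (fun i => n * M0 i))} (hw : w ∈ extNbrs n hs z) :
    ∃ μ, z.1 μ = 0 ∨ z.1 μ + 1 = n * M μ := by
  by_contra hcon
  push Not at hcon
  obtain ⟨hnb, hout⟩ := (mem_extNbrs hs).1 hw
  apply hout
  obtain ⟨μ, h | h⟩ := mem_nbrs.1 hnb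
  · have h' : (w.1 - fun i => (n : ℤ) * s i) = z.1 + Pi.single μ 1 := by
      rw [h, emb_val]; abel
    rw [h']
    exact (add_single_mem_of_not_face z.2 hcon μ).1
  · have h' : (w.1 - fun i => (n : ℤ) * s i) = z.1 - Pi.single μ 1 := by
      rw [h, emb_val]; abel
    rw [h']
    exact (add_single_mem_of_not_face z.2 hcon μ).2

/-! ### §4c The distance to `Ω₀^{(j)} ∖ Ω^{(j)}` -/

/-- `ω(y) = dist(y, Ω₀^{(j)} ∖ Ω^{(j)})`: the sup-distance from (the translate of) an inner unit site `y` to the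
outer unit sites that are not translates of inner unit sites (`= sInf ∅ = 0` if `□ = □₀`). [folklore] -/
def distOut {M M0 : Fin (d + 1) → ℕ} {s : Fin (d + 1) → ℤ} (hs : Fits M M0 s) (y : ↥(boxDom M)) : ℝ :=
  sInf ((fun v : ↥(boxDom M0) => supNorm ((emb hs y).1 - v.1)) '' {v | v.1 - s ∉ boxDom M})

/-- `ω ≥ 0`. [folklore] -/
theorem distOut_nonneg {M M0 : Fin (d + 1) → ℕ} {s : Fin (d + 1) → ℤ} (hs : Fits M M0 s) (y : ↥(boxDom M)) :
    0 ≤ distOut hs y := by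
  apply Real.sInf_nonneg
  rintro _ ⟨v, _, rfl⟩
  exact supNorm_nonneg _

/-- `ω(y) ≤ |y + s − v|` for every outer unit site `v` off the inner box. [folklore] -/
theorem distOut_le {M M0 : Fin (d + 1) → ℕ} {s : Fin (d + 1) → ℤ} (hs : Fits M M0 s) (y : ↥(boxDom M))
    {v : ↥(boxDom M0)} (hv : v.1 - s ∉ boxDom M) : distOut hs y ≤ supNorm ((emb hs y).1 - v.1) := by
  apply csInf_le
  · refine ⟨0, ?_⟩
    rintro _ ⟨v', _, rfl⟩
    exact supNorm_nonneg _
  · exact ⟨v, hv, rfl⟩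

/-- `ω` is `1`-Lipschitz for the sup-distance: `ω(y) ≤ |y − y′| + ω(y′)`. [folklore] -/
theorem distOut_le_rho_add {M M0 : Fin (d + 1) → ℕ} {s : Fin (d + 1) → ℤ} (hs : Fits M M0 s)
    (y y' : ↥(boxDom M)) : distOut hs y ≤ rho M y y' + distOut hs y' := by
  by_cases hne : ({v : ↥(boxDom M0) | v.1 - s ∉ boxDom M} : Set _).Nonempty
  · have hne' : ((fun v : ↥(boxDom M0) => supNorm ((emb hs y').1 - v.1)) ''
        {v | v.1 - s ∉ boxDom M}).Nonempty := hne.image _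
    have h1 : distOut hs y - rho M y y' ≤ distOut hs y' := by
      apply le_csInf hne'
      rintro _ ⟨v, hv, rfl⟩
      have h2 := distOut_le hs y hv
      have htri : supNorm ((emb hs y).1 - v.1)
          ≤ supNorm ((emb hs y).1 - (emb hs y').1) + supNorm ((emb hs y').1 - v.1) := by
        have := supNorm_add_le ((emb hs y).1 - (emb hs y').1) ((emb hs y').1 - v.1)
        rwa [sub_add_sub_cancel] at this
      have hrho : supNorm ((emb hs y).1 - (emb hs y').1) = rho M y y' := by
        simp only [emb_val, rho, add_sub_add_right_eq_sub]
      linarith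
    linarith
  · rw [Set.not_nonempty_iff_eq_empty] at hne
    have h0 : distOut hs y = 0 := by
      unfold distOut
      rw [hne, Set.image_empty, Real.sInf_empty]
    rw [h0]
    have := (rho_isPseudoDist M).nonneg y y'
    have := distOut_nonneg hs y'
    linarith

/-- a boundary bond at a fine point `z` shows `ω(y) ≤ |y − blk z| + 1` for every inner unit site `y`
(the unit block of the outer end of the bond is off the inner box and adjacent to `blk z`). [folklore] -/
theorem distOut_le_of_extNbrs {n : ℕ} (hn : 1 ≤ n) {M M0 : Fin (d + 1) → ℕ} {s : Fin (d + 1) → ℤ}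
    (hs : Fits M M0 s) {z : ↥(boxDom (fun i => n * M i))} {w : ↥(boxDom (fun i => n * M0 i))}
    (hw : w ∈ extNbrs n hs z) (y : ↥(boxDom M)) : distOut hs y ≤ supNorm (blk n z.1 - y.1) + 1 := by
  have hv : (⟨blk n w.1, blk_mem_boxDom hn w.2⟩ : ↥(boxDom M0)).1 - s ∉ boxDom M :=
    extNbrs_blk_not_mem hn hs hw
  have h1 := distOut_le hs y hv
  have h2 : supNorm ((emb hs y).1 - blk n w.1) ≤ supNorm ((emb hs y).1 - blk n (emb (hs.scale n) z).1)
      + supNorm (blk n (emb (hs.scale n) z).1 - blk n w.1) := by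
    have := supNorm_add_le ((emb hs y).1 - blk n (emb (hs.scale n) z).1)
      (blk n (emb (hs.scale n) z).1 - blk n w.1)
    rwa [sub_add_sub_cancel] at this
  have h3 : (emb hs y).1 - blk n (emb (hs.scale n) z).1 = -(blk n z.1 - y.1) := by
    rw [emb_val, emb_val, blk_add_mul hn]; abel
  rw [h3, B4TorusKernel.supNorm_neg] at h2
  have h4 := extNbrs_blk_le hn hs hw
  exact h1.trans (by linarith)

/-! ### §4d Counting the boundary points of a block -/

/-- at most `n^d` points of one `n`-block lie on a given coordinate hyperplane. [folklore] -/
theorem card_blk_face_le {n : ℕ} (hn : 1 ≤ n) (M : Fin (d + 1) → ℕ) (b : Fin (d + 1) → ℤ)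
    (μ : Fin (d + 1)) (c : ℤ) :
    (Finset.univ.filter fun z : ↥(boxDom (fun i => n * M i)) => blk n z.1 = b ∧ z.1 μ = c).card ≤ n ^ d := by
  classical
  haveI : NeZero n := ⟨by omega⟩
  have hcard : (Finset.univ : Finset (Fin d → Fin n)).card = n ^ d := by simp
  rw [← hcard]
  refine Finset.card_le_card_of_injOn (fun z => Fin.removeNth μ (B4Green244.offset n z.1))
    (fun _ _ => Finset.mem_coe.2 (Finset.mem_univ _)) ?_
  intro z hz z' hz' heq
  simp only [Finset.coe_filter, Finset.mem_univ, true_and, Set.mem_setOf_eq] at hz hz'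
  have hμ : B4Green244.offset n z.1 μ = B4Green244.offset n z'.1 μ := by
    apply Fin.ext
    simp only [B4Green244.offset]
    rw [hz.2, hz'.2]
  have hoff : B4Green244.offset n z.1 = B4Green244.offset n z'.1 := by
    rw [← Fin.insertNth_self_removeNth μ (B4Green244.offset n z.1),
      ← Fin.insertNth_self_removeNth μ (B4Green244.offset n z'.1), hμ]
    exact congrArg _ heq
  apply Subtype.ext
  rw [← B4Green244.finePt_coarse_offset n z.1, ← B4Green244.finePt_coarse_offset n z'.1, hoff,
    ← blk_eq_coarse, ← blk_eq_coarse, hz.1, hz'.1]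

/-- at most `2(d+1)·n^d` points of one `n`-block carry a boundary bond. [folklore] -/
theorem card_blk_bdry_le {n : ℕ} (hn : 1 ≤ n) {M M0 : Fin (d + 1) → ℕ} {s : Fin (d + 1) → ℤ}
    (hs : Fits M M0 s) (b : Fin (d + 1) → ℤ) :
    (Finset.univ.filter fun z : ↥(boxDom (fun i => n * M i)) =>
        blk n z.1 = b ∧ (extNbrs n hs z).Nonempty).card ≤ 2 * (d + 1) * n ^ d := by
  classical
  have hsub : (Finset.univ.filter fun z : ↥(boxDom (fun i => n * M i)) =>
        blk n z.1 = b ∧ (extNbrs n hs z).Nonempty)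
      ⊆ Finset.univ.biUnion (fun μ : Fin (d + 1) =>
          (Finset.univ.filter fun z : ↥(boxDom (fun i => n * M i)) => blk n z.1 = b ∧ z.1 μ = 0)
          ∪ (Finset.univ.filter fun z : ↥(boxDom (fun i => n * M i)) =>
              blk n z.1 = b ∧ z.1 μ = (n : ℤ) * M μ - 1)) := by
    intro z hz
    simp only [Finset.mem_filter, Finset.mem_univ, true_and] at hz
    obtain ⟨w, hw⟩ := hz.2
    obtain ⟨μ, hμ⟩ := extNbrs_face hs hw
    simp only [Finset.mem_biUnion, Finset.mem_univ, true_and, Finset.mem_union, Finset.mem_filter]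
    refine ⟨μ, ?_⟩
    rcases hμ with h | h
    · exact Or.inl ⟨hz.1, h⟩
    · refine Or.inr ⟨hz.1, ?_⟩
      linarith
  refine (Finset.card_le_card hsub).trans (Finset.card_biUnion_le.trans ?_)
  have hμ : ∀ μ ∈ (Finset.univ : Finset (Fin (d + 1))),
      ((Finset.univ.filter fun z : ↥(boxDom (fun i => n * M i)) => blk n z.1 = b ∧ z.1 μ = 0)
        ∪ (Finset.univ.filter fun z : ↥(boxDom (fun i => n * M i)) =>
            blk n z.1 = b ∧ z.1 μ = (n : ℤ) * M μ - 1)).card ≤ 2 * n ^ d := by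
    intro μ _
    have h1 := card_blk_face_le hn M b μ 0
    have h2 := card_blk_face_le hn M b μ ((n : ℤ) * M μ - 1)
    exact (Finset.card_union_le _ _).trans (by omega)
  refine (Finset.sum_le_sum hμ).trans ?_
  rw [Finset.sum_const, Finset.card_univ, Fintype.card_fin, smul_eq_mul]
  exact le_of_eq (by ring)

/-! ### §4e (5.5): the identity and the bound for `Δ^{(j)}(□) − Δ^{(j)}(□₀)` -/

/-- the block-integrated outer Green function over two translated inner blocks, pulled back to the inner fine
box. [folklore] -/
theorem blockSum_outer_eq {n : ℕ} (hn : 1 ≤ n) (a m2 : ℝ) {M M0 : Fin (d + 1) → ℕ} {s : Fin (d + 1) → ℤ}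
    (hs : Fits M M0 s) (y y' : ↥(boxDom M)) :
    (indB n M0 * (boxOpR n a m2 M0)⁻¹ * (indB n M0)ᵀ) (emb hs y) (emb hs y')
      = ∑ x ∈ Finset.univ.filter (fun x : ↥(boxDom (fun i => n * M i)) => blk n x.1 = y.1),
          ∑ x' ∈ Finset.univ.filter (fun x' : ↥(boxDom (fun i => n * M i)) => blk n x'.1 = y'.1),
            (boxOpR n a m2 M0)⁻¹ (emb (hs.scale n) x) (emb (hs.scale n) x') := by
  rw [indB_mul_mul_transpose_apply]
  simp only [emb_val]
  rw [sum_filter_blk_outer_eq hn hs _ y.2]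
  refine Finset.sum_congr rfl fun x _ => ?_
  rw [sum_filter_blk_outer_eq hn hs _ y'.2]

/-- **(5.5) AS AN EXACT IDENTITY.**  The difference of the block-integrated Neumann Green functions of the two
boxes, `Σ_{x∈B(y)}Σ_{x′∈B(y′)} G(□)(x,x′) − Σ_{w∈B(y+s)}Σ_{w′∈B(y′+s)} G(□₀)(w,w′)`, equals
`Σ_{z ∈ X} [Σ_{x∈B(y)} G(□)(z,x)]·n²·Σ_{w ∈ ∂-nbrs(z)} Σ_{x′∈B(y′)}(G(□₀)(τz,τx′) − G(□₀)(w,τx′))` — a sum over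
the bonds of `□₀` crossing `∂□` of (block row of `G(□)`) × (block-row DIFFERENCE of `G(□₀)` across the bond).
[folklore] -/
theorem blockSum_diff_eq {n : ℕ} (hn : 1 ≤ n) {a m2 : ℝ} (ha : 0 < a) (hm : 0 ≤ m2)
    {M M0 : Fin (d + 1) → ℕ} (hM : ∀ i, 1 ≤ M i) (hM0 : ∀ i, 1 ≤ M0 i) {s : Fin (d + 1) → ℤ}
    (hs : Fits M M0 s) (y y' : ↥(boxDom M)) :
    (indB n M * (boxOpR n a m2 M)⁻¹ * (indB n M)ᵀ) y y'
        - (indB n M0 * (boxOpR n a m2 M0)⁻¹ * (indB n M0)ᵀ) (emb hs y) (emb hs y')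
      = ∑ z : ↥(boxDom (fun i => n * M i)),
          (∑ x ∈ Finset.univ.filter (fun x : ↥(boxDom (fun i => n * M i)) => blk n x.1 = y.1),
              (boxOpR n a m2 M)⁻¹ z x)
          * ((n : ℝ) ^ 2 * ∑ w ∈ extNbrs n hs z,
              ∑ x' ∈ Finset.univ.filter (fun x' : ↥(boxDom (fun i => n * M i)) => blk n x'.1 = y'.1),
                ((boxOpR n a m2 M0)⁻¹ (emb (hs.scale n) z) (emb (hs.scale n) x')
                  - (boxOpR n a m2 M0)⁻¹ w (emb (hs.scale n) x'))) := by
  rw [indB_mul_mul_transpose_apply, blockSum_outer_eq hn a m2 hs, ← Finset.sum_sub_distrib]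
  have h1 : ∀ x ∈ Finset.univ.filter (fun x : ↥(boxDom (fun i => n * M i)) => blk n x.1 = y.1),
      (∑ x' ∈ Finset.univ.filter (fun x' : ↥(boxDom (fun i => n * M i)) => blk n x'.1 = y'.1),
          (boxOpR n a m2 M)⁻¹ x x')
        - ∑ x' ∈ Finset.univ.filter (fun x' : ↥(boxDom (fun i => n * M i)) => blk n x'.1 = y'.1),
          (boxOpR n a m2 M0)⁻¹ (emb (hs.scale n) x) (emb (hs.scale n) x')
      = ∑ z : ↥(boxDom (fun i => n * M i)),
          ∑ x' ∈ Finset.univ.filter (fun x' : ↥(boxDom (fun i => n * M i)) => blk n x'.1 = y'.1),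
            (boxOpR n a m2 M)⁻¹ x z * ((n : ℝ) ^ 2 * ∑ w ∈ extNbrs n hs z,
              ((boxOpR n a m2 M0)⁻¹ (emb (hs.scale n) z) (emb (hs.scale n) x')
                - (boxOpR n a m2 M0)⁻¹ w (emb (hs.scale n) x'))) := by
    intro x _
    rw [← Finset.sum_sub_distrib, Finset.sum_comm]
    refine Finset.sum_congr rfl fun x' _ => ?_
    exact green_inner_sub_outer hn ha hm hM hM0 hs x x'
  rw [Finset.sum_congr rfl h1, Finset.sum_comm]
  refine Finset.sum_congr rfl fun z _ => ?_
  have hsym : ∀ x, (boxOpR n a m2 M)⁻¹ z x = (boxOpR n a m2 M)⁻¹ x z := fun x =>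
    ((boxOpR_inv_isSymm n a m2 M).apply z x).symm
  conv_rhs => rw [Finset.sum_comm, Finset.mul_sum, Finset.sum_mul_sum]
  refine Finset.sum_congr rfl fun x _ => Finset.sum_congr rfl fun x' _ => ?_
  rw [hsym x, Finset.mul_sum]

/-- the effective actions of the two boxes differ by `−(a²/n^{d+1})·`(the block-sum difference): the identity
parts `a·1` agree on translated sites. [folklore] -/
theorem Keff_sub_Keff_emb {n : ℕ} (a m2 : ℝ) {M M0 : Fin (d + 1) → ℕ} {s : Fin (d + 1) → ℤ}
    (hs : Fits M M0 s) (y y' : ↥(boxDom M)) :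
    Keff n a m2 M y y' - Keff n a m2 M0 (emb hs y) (emb hs y')
      = -(a ^ 2 * ((n : ℝ) ^ (d + 1))⁻¹) *
        ((indB n M * (boxOpR n a m2 M)⁻¹ * (indB n M)ᵀ) y y'
          - (indB n M0 * (boxOpR n a m2 M0)⁻¹ * (indB n M0)ᵀ) (emb hs y) (emb hs y')) := by
  simp only [Keff, Matrix.sub_apply, Matrix.smul_apply, Matrix.one_apply, smul_eq_mul,
    (emb_injective hs).eq_iff]
  ring

/-- **B4 (5.5) FOR NESTED NEUMANN BOXES — KERNEL-CHECKED, HYPOTHESIS-FREE** [Balaban, CMP 89 (1983), p.594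
(5.5) at `A = 0`, `Ω = □ ⊂ Ω₀ = □₀` boxes that are unions of `L^j`-blocks].  There are `δ, c > 0` depending
only on `d` and the window `[a₋,a₊] ∋ a`, `[0,m²₊] ∋ m²` (`a₋ > 0`) such that for EVERY `n = L^j ≥ 1`, every
pair of nested unit boxes `s + Π[0,M_μ) ⊂ Π[0,M₀_μ)` and all inner unit sites `y, y′`:
`|Δ^{(j)}(□)(y,y′) − Δ^{(j)}(□₀)(y+s, y′+s)| ≤ c·exp(−δ(|y−y′|_∞ + dist(y, □₀^{(j)}∖□^{(j)}) + dist(y′, □₀^{(j)}∖□^{(j)})))`,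
`Δ^{(j)}(□) = a − a²Q_jG_j(□)Q_j^* = Keff n a m² M`.  Proof: `blockSum_diff_eq` + block-row decay and block-row
derivative decay of `G(□)`, `G(□₀)` [(2.35), `B4BoxCov237`] + at most `2(d+1)n^d` boundary points per block
(the `n^{d+1}` of the block derivative and of the block volume cancel the `n^{-(d+1)}` exactly).
[cite: Balaban1983RegularityDecay, p.594 (5.5); p.574 (1.19)–(1.20)] -/
theorem keff55_twoBox (d : ℕ) (aminus aplus m2plus : ℝ) (ha : 0 < aminus) :
    ∃ δ c : ℝ, 0 < δ ∧ 0 < c ∧ ∀ (n : ℕ), 1 ≤ n → ∀ (a m2 : ℝ), aminus ≤ a → a ≤ aplus → 0 ≤ m2 → m2 ≤ m2plus →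
      ∀ (M M0 : Fin (d + 1) → ℕ), (∀ i, 1 ≤ M i) → ∀ (s : Fin (d + 1) → ℤ) (hs : Fits M M0 s)
        (y y' : ↥(boxDom M)),
          |Keff n a m2 M y y' - Keff n a m2 M0 (emb hs y) (emb hs y')|
            ≤ c * Real.exp (-(δ * (rho M y y' + distOut hs y + distOut hs y'))) := by
  obtain ⟨κ, C, hκ, hC, hrow⟩ := green_blockRow_bound d aminus aplus m2plus ha
  obtain ⟨κ', C', hκ', hC', hder⟩ := green_blockRowDiff_bound d aminus aplus m2plus ha
  have hκ₁ : 0 < min κ κ' := lt_min hκ hκ'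
  have hΛ : 0 ≤ latticeConst (d + 1) (min κ κ' / 2) := latticeConst_nonneg _ (by positivity)
  refine ⟨min κ κ' / 4,
    aplus ^ 2 * (4 * ((d : ℝ) + 1) ^ 2 * (C * (C' * Real.exp κ')) * Real.exp (min κ κ' / 2)
      * latticeConst (d + 1) (min κ κ' / 2)) + 1, by positivity, by positivity, ?_⟩
  intro n hn a m2 h1 h2 h3 h4 M M0 hM s hs y y'
  have ha' : 0 < a := lt_of_lt_of_le ha h1
  have hM0 : ∀ i, 1 ≤ M0 i := hs.one_le hM
  have hnR : (1 : ℝ) ≤ n := by exact_mod_cast hn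
  have hnpos : (0 : ℝ) < n := by linarith
  set κ₁ := min κ κ' with hκ₁def
  have hk1 : κ₁ ≤ κ := min_le_left _ _
  have hk2 : κ₁ ≤ κ' := min_le_right _ _
  set T := rho M y y' + distOut hs y + distOut hs y' with hT
  set S := Finset.univ.filter (fun z : ↥(boxDom (fun i => n * M i)) => (extNbrs n hs z).Nonempty) with hS
  rw [Keff_sub_Keff_emb a m2 hs, blockSum_diff_eq hn ha' h3 hM hM0 hs, abs_mul, abs_neg,
    abs_of_nonneg (by positivity : 0 ≤ a ^ 2 * ((n : ℝ) ^ (d + 1))⁻¹)]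
  -- the constant in front of the boundary sum
  set K := 2 * ((d : ℝ) + 1) * (C * (C' * Real.exp κ')) * Real.exp (κ₁ / 2) * Real.exp (-(κ₁ / 4 * T))
    with hK
  have hKnn : 0 ≤ K := by positivity
  -- Step 1: the term of a fine point `z`
  have hz : ∀ z : ↥(boxDom (fun i => n * M i)),
      |(∑ x ∈ Finset.univ.filter (fun x : ↥(boxDom (fun i => n * M i)) => blk n x.1 = y.1),
          (boxOpR n a m2 M)⁻¹ z x)
        * ((n : ℝ) ^ 2 * ∑ w ∈ extNbrs n hs z,
            ∑ x' ∈ Finset.univ.filter (fun x' : ↥(boxDom (fun i => n * M i)) => blk n x'.1 = y'.1),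
              ((boxOpR n a m2 M0)⁻¹ (emb (hs.scale n) z) (emb (hs.scale n) x')
                - (boxOpR n a m2 M0)⁻¹ w (emb (hs.scale n) x')))|
        ≤ K * n * (if z ∈ S then Real.exp (-(κ₁ / 2 * supNorm (blk n z.1 - y.1))) else 0) := by
    intro z
    by_cases hzS : z ∈ S
    · rw [if_pos hzS]
      have hne : (extNbrs n hs z).Nonempty := by simpa [hS] using hzS
      obtain ⟨w₀, hw₀⟩ := hne
      set ρ₁ := supNorm (blk n z.1 - y.1) with hρ₁
      set ρ₂ := supNorm (blk n z.1 - y'.1) with hρ₂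
      have hρ₁nn : 0 ≤ ρ₁ := supNorm_nonneg _
      have hρ₂nn : 0 ≤ ρ₂ := supNorm_nonneg _
      -- the block row of `G(□)`
      have hr : |∑ x ∈ Finset.univ.filter (fun x : ↥(boxDom (fun i => n * M i)) => blk n x.1 = y.1),
          (boxOpR n a m2 M)⁻¹ z x| ≤ C * Real.exp (-(κ * ρ₁)) := by
        rw [Finset.sum_filter]
        exact hrow n hn a m2 h1 h2 h3 h4 M hM z y.1 y.2
      -- the block-row difference of `G(□₀)` across one boundary bond
      have hw : ∀ w ∈ extNbrs n hs z,
          |(n : ℝ) * ∑ x' ∈ Finset.univ.filter (fun x' : ↥(boxDom (fun i => n * M i)) => blk n x'.1 = y'.1),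
              ((boxOpR n a m2 M0)⁻¹ (emb (hs.scale n) z) (emb (hs.scale n) x')
                - (boxOpR n a m2 M0)⁻¹ w (emb (hs.scale n) x'))|
            ≤ C' * Real.exp κ' * Real.exp (-(κ' * ρ₂)) := by
        intro w hw
        have hy's : y'.1 + s ∈ boxDom M0 := add_mem_boxDom hs y'.2
        rw [← sum_filter_blk_outer_eq hn hs
          (fun w' => (boxOpR n a m2 M0)⁻¹ (emb (hs.scale n) z) w' - (boxOpR n a m2 M0)⁻¹ w w') y'.2,
          Finset.sum_filter]
        have hbz : blk n (emb (hs.scale n) z).1 - (y'.1 + s) = blk n z.1 - y'.1 := by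
          rw [emb_val, blk_add_mul hn]; abel
        have hexpκ' : (1 : ℝ) ≤ Real.exp κ' := Real.one_le_exp hκ'.le
        obtain ⟨μ, h | h⟩ := extNbrs_step hs hw
        · -- `w = τz + e_μ`: the derivative bound at `x = τz`
          have hb := hder n hn a m2 h1 h2 h3 h4 M0 hM0 μ (emb (hs.scale n) z) w h (y'.1 + s) hy's
          rw [hbz] at hb
          have hneg : (n : ℝ) * ∑ w' : ↥(boxDom (fun i => n * M0 i)),
              (if blk n w'.1 = y'.1 + s then
                (boxOpR n a m2 M0)⁻¹ (emb (hs.scale n) z) w' - (boxOpR n a m2 M0)⁻¹ w w' else 0)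
            = -((n : ℝ) * ∑ w' : ↥(boxDom (fun i => n * M0 i)),
              (if blk n w'.1 = y'.1 + s then
                (boxOpR n a m2 M0)⁻¹ w w' - (boxOpR n a m2 M0)⁻¹ (emb (hs.scale n) z) w' else 0)) := by
            rw [← mul_neg, ← Finset.sum_neg_distrib]
            congr 1
            refine Finset.sum_congr rfl fun w' _ => ?_
            split_ifs <;> ring
          rw [hneg, abs_neg]
          refine hb.trans ?_
          have : C' * Real.exp (-(κ' * ρ₂)) ≤ C' * Real.exp κ' * Real.exp (-(κ' * ρ₂)) := by
            have h0 : 0 ≤ C' * Real.exp (-(κ' * ρ₂)) := by positivity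
            nlinarith
          exact this
        · -- `w = τz − e_μ`: the derivative bound at `x = w`
          have h' : (emb (hs.scale n) z).1 = w.1 + Pi.single μ 1 := by rw [h, sub_add_cancel]
          have hb := hder n hn a m2 h1 h2 h3 h4 M0 hM0 μ w (emb (hs.scale n) z) h' (y'.1 + s) hy's
          refine hb.trans ?_
          have htri : ρ₂ ≤ 1 + supNorm (blk n w.1 - (y'.1 + s)) := by
            have := supNorm_add_le (blk n (emb (hs.scale n) z).1 - blk n w.1) (blk n w.1 - (y'.1 + s))
            rw [sub_add_sub_cancel, hbz] at this
            linarith [extNbrs_blk_le hn hs hw]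
          rw [mul_assoc, ← Real.exp_add]
          refine mul_le_mul_of_nonneg_left (Real.exp_le_exp.2 ?_) hC'
          nlinarith [supNorm_nonneg (blk n w.1 - (y'.1 + s))]
      -- summing the bonds at `z`
      have hsumw : |(n : ℝ) ^ 2 * ∑ w ∈ extNbrs n hs z,
          ∑ x' ∈ Finset.univ.filter (fun x' : ↥(boxDom (fun i => n * M i)) => blk n x'.1 = y'.1),
            ((boxOpR n a m2 M0)⁻¹ (emb (hs.scale n) z) (emb (hs.scale n) x')
              - (boxOpR n a m2 M0)⁻¹ w (emb (hs.scale n) x'))|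
          ≤ n * (2 * ((d : ℝ) + 1) * (C' * Real.exp κ' * Real.exp (-(κ' * ρ₂)))) := by
        rw [pow_two, mul_assoc, abs_mul, abs_of_nonneg hnpos.le, Finset.mul_sum]
        refine mul_le_mul_of_nonneg_left ?_ hnpos.le
        refine (Finset.abs_sum_le_sum_abs _ _).trans ((Finset.sum_le_sum hw).trans ?_)
        rw [Finset.sum_const, nsmul_eq_mul]
        refine mul_le_mul_of_nonneg_right ?_ (by positivity)
        exact_mod_cast card_extNbrs_le hs z
      -- the exponents: `|y−y′| + ω(y) + ω(y′) ≤ 2ρ₁ + 2ρ₂ + 2`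
      have hT_le : T ≤ 2 * ρ₁ + 2 * ρ₂ + 2 := by
        have e1 : rho M y y' ≤ ρ₁ + ρ₂ := by
          have := supNorm_add_le (y.1 - blk n z.1) (blk n z.1 - y'.1)
          rw [sub_add_sub_cancel, ← B4TorusKernel.supNorm_neg (y.1 - blk n z.1), neg_sub] at this
          exact this
        have e2 := distOut_le_of_extNbrs hn hs hw₀ y
        have e3 := distOut_le_of_extNbrs hn hs hw₀ y'
        linarith
      have hexp : Real.exp (-(κ * ρ₁)) * Real.exp (-(κ' * ρ₂))
          ≤ Real.exp (κ₁ / 2) * Real.exp (-(κ₁ / 4 * T)) * Real.exp (-(κ₁ / 2 * ρ₁)) := by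
        rw [← Real.exp_add, ← Real.exp_add, ← Real.exp_add]
        apply Real.exp_le_exp.2
        have f1 : 0 ≤ (κ - κ₁) * ρ₁ := mul_nonneg (by linarith) hρ₁nn
        have f2 : 0 ≤ (κ' - κ₁) * ρ₂ := mul_nonneg (by linarith) hρ₂nn
        have f3 : κ₁ * T ≤ κ₁ * (2 * ρ₁ + 2 * ρ₂ + 2) := mul_le_mul_of_nonneg_left hT_le hκ₁.le
        have f4 : 0 ≤ κ₁ * ρ₂ := mul_nonneg hκ₁.le hρ₂nn
        nlinarith
      calc |(∑ x ∈ Finset.univ.filter (fun x : ↥(boxDom (fun i => n * M i)) => blk n x.1 = y.1),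
              (boxOpR n a m2 M)⁻¹ z x)
            * ((n : ℝ) ^ 2 * ∑ w ∈ extNbrs n hs z,
              ∑ x' ∈ Finset.univ.filter (fun x' : ↥(boxDom (fun i => n * M i)) => blk n x'.1 = y'.1),
                ((boxOpR n a m2 M0)⁻¹ (emb (hs.scale n) z) (emb (hs.scale n) x')
                  - (boxOpR n a m2 M0)⁻¹ w (emb (hs.scale n) x')))|
          ≤ (C * Real.exp (-(κ * ρ₁))) * (n * (2 * ((d : ℝ) + 1) * (C' * Real.exp κ' * Real.exp (-(κ' * ρ₂))))) := by
            rw [abs_mul]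
            exact mul_le_mul hr hsumw (abs_nonneg _) (by positivity)
        _ = 2 * ((d : ℝ) + 1) * (C * (C' * Real.exp κ')) * n * (Real.exp (-(κ * ρ₁)) * Real.exp (-(κ' * ρ₂))) := by
            ring
        _ ≤ 2 * ((d : ℝ) + 1) * (C * (C' * Real.exp κ')) * n
              * (Real.exp (κ₁ / 2) * Real.exp (-(κ₁ / 4 * T)) * Real.exp (-(κ₁ / 2 * ρ₁))) :=
            mul_le_mul_of_nonneg_left hexp (by positivity)
        _ = K * n * Real.exp (-(κ₁ / 2 * ρ₁)) := by rw [hK]; ring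
    · rw [if_neg hzS, mul_zero]
      have hE : extNbrs n hs z = ∅ := by
        simpa [hS, Finset.not_nonempty_iff_eq_empty] using hzS
      rw [hE, Finset.sum_empty, mul_zero, mul_zero, abs_zero]
  -- Step 2: at most `2(d+1)n^d` boundary points per block
  have hsumS : ∑ z ∈ S, Real.exp (-(κ₁ / 2 * supNorm (blk n z.1 - y.1)))
      ≤ ((2 * (d + 1) * n ^ d : ℕ) : ℝ) * latticeConst (d + 1) (κ₁ / 2) := by
    have hfib := Finset.sum_fiberwise' S
      (fun z : ↥(boxDom (fun i => n * M i)) => (⟨blk n z.1, blk_mem_boxDom hn z.2⟩ : ↥(boxDom M)))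
      (fun b => Real.exp (-(κ₁ / 2 * supNorm (b.1 - y.1))))
    rw [← hfib]
    have hfiber : ∀ b : ↥(boxDom M),
        (S.filter fun z => (⟨blk n z.1, blk_mem_boxDom hn z.2⟩ : ↥(boxDom M)) = b).card
          ≤ 2 * (d + 1) * n ^ d := by
      intro b
      refine le_trans (Finset.card_le_card ?_) (card_blk_bdry_le hn hs b.1)
      intro z hz
      simp only [hS, Finset.mem_filter, Finset.mem_univ, true_and] at hz ⊢
      exact ⟨congrArg Subtype.val hz.2, hz.1⟩
    calc ∑ b : ↥(boxDom M), ∑ z ∈ S with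
            (⟨blk n z.1, blk_mem_boxDom hn z.2⟩ : ↥(boxDom M)) = b,
              Real.exp (-(κ₁ / 2 * supNorm (b.1 - y.1)))
        = ∑ b : ↥(boxDom M), ((S.filter fun z =>
            (⟨blk n z.1, blk_mem_boxDom hn z.2⟩ : ↥(boxDom M)) = b).card : ℝ)
              * Real.exp (-(κ₁ / 2 * supNorm (b.1 - y.1))) := by
          refine Finset.sum_congr rfl fun b _ => ?_
          rw [Finset.sum_const, nsmul_eq_mul]
      _ ≤ ∑ b : ↥(boxDom M), ((2 * (d + 1) * n ^ d : ℕ) : ℝ)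
              * Real.exp (-(κ₁ / 2 * supNorm (b.1 - y.1))) := by
          refine Finset.sum_le_sum fun b _ => mul_le_mul_of_nonneg_right ?_ (by positivity)
          exact_mod_cast hfiber b
      _ = ((2 * (d + 1) * n ^ d : ℕ) : ℝ) * ∑ b : ↥(boxDom M), Real.exp (-(κ₁ / 2 * rho M y b)) := by
          rw [Finset.mul_sum]
          refine Finset.sum_congr rfl fun b _ => ?_
          rw [rho, ← B4TorusKernel.supNorm_neg (y.1 - b.1), neg_sub]
      _ ≤ ((2 * (d + 1) * n ^ d : ℕ) : ℝ) * latticeConst (d + 1) (κ₁ / 2) :=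
          mul_le_mul_of_nonneg_left (rho_sumBound M (κ₁ / 2) (by positivity) y) (by positivity)
  -- Step 3: assembling
  have ha2 : a ^ 2 ≤ aplus ^ 2 := pow_le_pow_left₀ ha'.le h2 2
  have hpow : ((n : ℝ) ^ (d + 1))⁻¹ * (n * (((2 * (d + 1) * n ^ d : ℕ) : ℝ))) = 2 * ((d : ℝ) + 1) := by
    have hne : (n : ℝ) ^ (d + 1) ≠ 0 := by positivity
    field_simp
    push_cast
    ring
  calc a ^ 2 * ((n : ℝ) ^ (d + 1))⁻¹ * |∑ z : ↥(boxDom (fun i => n * M i)),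
          (∑ x ∈ Finset.univ.filter (fun x : ↥(boxDom (fun i => n * M i)) => blk n x.1 = y.1),
              (boxOpR n a m2 M)⁻¹ z x)
          * ((n : ℝ) ^ 2 * ∑ w ∈ extNbrs n hs z,
              ∑ x' ∈ Finset.univ.filter (fun x' : ↥(boxDom (fun i => n * M i)) => blk n x'.1 = y'.1),
                ((boxOpR n a m2 M0)⁻¹ (emb (hs.scale n) z) (emb (hs.scale n) x')
                  - (boxOpR n a m2 M0)⁻¹ w (emb (hs.scale n) x')))|
      ≤ a ^ 2 * ((n : ℝ) ^ (d + 1))⁻¹ * ∑ z : ↥(boxDom (fun i => n * M i)),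
          K * n * (if z ∈ S then Real.exp (-(κ₁ / 2 * supNorm (blk n z.1 - y.1))) else 0) := by
        refine mul_le_mul_of_nonneg_left ((Finset.abs_sum_le_sum_abs _ _).trans (Finset.sum_le_sum
          fun z _ => hz z)) (by positivity)
    _ = a ^ 2 * ((n : ℝ) ^ (d + 1))⁻¹ * (K * n * ∑ z ∈ S, Real.exp (-(κ₁ / 2 * supNorm (blk n z.1 - y.1)))) := by
        rw [← Finset.mul_sum, Finset.sum_ite_mem, Finset.univ_inter]
    _ ≤ a ^ 2 * ((n : ℝ) ^ (d + 1))⁻¹ * (K * n * (((2 * (d + 1) * n ^ d : ℕ) : ℝ)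
          * latticeConst (d + 1) (κ₁ / 2))) := by
        refine mul_le_mul_of_nonneg_left (mul_le_mul_of_nonneg_left hsumS (by positivity)) (by positivity)
    _ = a ^ 2 * K * latticeConst (d + 1) (κ₁ / 2)
          * (((n : ℝ) ^ (d + 1))⁻¹ * (n * (((2 * (d + 1) * n ^ d : ℕ) : ℝ)))) := by ring
    _ = a ^ 2 * (4 * ((d : ℝ) + 1) ^ 2 * (C * (C' * Real.exp κ')) * Real.exp (κ₁ / 2)
          * latticeConst (d + 1) (κ₁ / 2)) * Real.exp (-(κ₁ / 4 * T)) := by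
        rw [hpow, hK]; ring
    _ ≤ (aplus ^ 2 * (4 * ((d : ℝ) + 1) ^ 2 * (C * (C' * Real.exp κ')) * Real.exp (κ₁ / 2)
          * latticeConst (d + 1) (κ₁ / 2)) + 1) * Real.exp (-(κ₁ / 4 * T)) := by
        refine mul_le_mul_of_nonneg_right ?_ (by positivity)
        have h0 : 0 ≤ 4 * ((d : ℝ) + 1) ^ 2 * (C * (C' * Real.exp κ')) * Real.exp (κ₁ / 2)
            * latticeConst (d + 1) (κ₁ / 2) := by positivity
        nlinarith

/-! ## §5 (1.19)–(1.20): `δC_Λ^{(k)}(□, □₀) = C_Λ^{(k)}(□) − C_Λ^{(k)}(□₀)` for nested Neumann boxes -/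

/-- weakening the constants of (5.6): a larger `c₀` and a smaller rate. [folklore] -/
theorem hyp56_weaken {m : Type*} [Fintype m] {ρ : m → m → ℝ} (hρ : ∀ p q, 0 ≤ ρ p q)
    {A : Matrix m m ℝ} {γ₀ c₀ δ₀ c₀' δ₀' : ℝ} (h : Hyp56 ρ A γ₀ c₀ δ₀) (hc0 : 0 ≤ c₀) (hc : c₀ ≤ c₀')
    (hδ : δ₀' ≤ δ₀) : Hyp56 ρ A γ₀ c₀' δ₀' := by
  refine ⟨h.1, h.2.1, fun p q => (h.2.2 p q).trans ?_⟩
  have h1 : Real.exp (-(δ₀ * ρ p q)) ≤ Real.exp (-(δ₀' * ρ p q)) :=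
    Real.exp_le_exp.2 (by nlinarith [hρ p q])
  calc c₀ * Real.exp (-(δ₀ * ρ p q)) ≤ c₀ * Real.exp (-(δ₀' * ρ p q)) := mul_le_mul_of_nonneg_left h1 hc0
    _ ≤ c₀' * Real.exp (-(δ₀' * ρ p q)) := mul_le_mul_of_nonneg_right hc (Real.exp_pos _).le

/-- the block-averaging projection of the outer box restricted to (translates of) inner unit sites is the inner
block-averaging projection: the inner box is a union of whole `L`-blocks (`L = ℓ + 1`). [folklore] -/
theorem blockAvgP_submatrix (ℓ : ℕ) {M' M0' : Fin (d + 1) → ℕ} {s' : Fin (d + 1) → ℤ} (hs' : Fits M' M0' s') :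
    (blockAvgP ℓ M0').submatrix (emb (hs'.scale (ℓ + 1))) (emb (hs'.scale (ℓ + 1))) = blockAvgP ℓ M' := by
  ext y y'
  simp only [Matrix.submatrix_apply, blockAvgP, Matrix.of_apply, emb_val,
    blk_add_mul (show 1 ≤ ℓ + 1 by omega), add_left_inj]

/-- the covariance operator `Δ^{(k)}(□₀) + aL^{-2}P` of the outer box restricted to the inner unit sites is the
restricted outer effective action plus the INNER `aL^{-2}P`. [folklore] -/
theorem covOp_submatrix (n ℓ : ℕ) (a₁ a₂ m2 : ℝ) {M' M0' : Fin (d + 1) → ℕ} {s' : Fin (d + 1) → ℤ}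
    (hs' : Fits M' M0' s') :
    (covOp n ℓ a₁ a₂ m2 M0').submatrix (emb (hs'.scale (ℓ + 1))) (emb (hs'.scale (ℓ + 1)))
      = (Keff n a₁ m2 (fun i => (ℓ + 1) * M0' i)).submatrix (emb (hs'.scale (ℓ + 1))) (emb (hs'.scale (ℓ + 1)))
        + (a₂ / ((ℓ : ℝ) + 1) ^ 2) • blockAvgP ℓ M' := by
  simp only [covOp, Matrix.submatrix_add, Matrix.submatrix_smul, Pi.add_apply, Pi.smul_apply]
  rw [blockAvgP_submatrix ℓ hs']

/-- the sup-distance is translation invariant: `ρ_{□₀}(τy, τy′) = ρ_{□}(y, y′)`. [folklore] -/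
theorem rho_emb {N N0 : Fin (d + 1) → ℕ} {s : Fin (d + 1) → ℤ} (h : Fits N N0 s) :
    (fun y y' => rho N0 (emb h y) (emb h y')) = rho N := by
  funext y y'
  simp only [rho, emb_val, add_sub_add_right_eq_sub]

/-- **B4 (1.19)–(1.20) FOR NESTED NEUMANN BOXES — KERNEL-CHECKED, HYPOTHESIS-FREE** [Balaban, CMP 89 (1983),
p.574 (1.19)–(1.20) at `A = 0`, `Ω = □ ⊂ Ω₀ = □₀`, via p.594: (5.5) + the Sect. 5 Theorem (5.10)].
For `d`, `L = ℓ + 1 ≥ 2` and a window `a_k ∈ [a₋,a₊]`, `m_k² ∈ [0,m²₊]`, `a ∈ [a2₋, a2₊]` (`a₋, a2₋ > 0`) there are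
`δ, c > 0` such that for EVERY `n = L^k ≥ 1`, every nested pair of boxes `□ = L(s′ + Π[0,M′_μ)) ⊂ □₀ =
L·Π[0,M₀′_μ)` (unions of `L`-blocks of unit sites), every set `Λ ⊆ □^{(k)}` of inner unit sites (an injection
`e`) and all `x, x′ ∈ Λ`:
`|δC_Λ^{(k)}(□, □₀; x, x′)| = |C_Λ^{(k)}(□; x, x′) − C_Λ^{(k)}(□₀; x, x′)|
   ≤ c·exp(−δ(|x − x′|_∞ + dist(x, □₀^{(k)} ∖ □^{(k)}) + dist(x′, □₀^{(k)} ∖ □^{(k)})))`,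
where `C_Λ^{(k)}(□) = ((Δ^{(k)}(□) + aL^{-2}P)↾_Λ)^{-1}` (`covOpSub`) and `C_Λ^{(k)}(□₀)` is the same for the
outer box with `Λ` translated (`e ↦ τ ∘ e`).  Constants uniform in `k`, both boxes, the shift, `Λ` and the
window.  Proof = the print's route: (5.5) (`keff55_twoBox`) is (5.9) for `B = Δ^{(k)}(□) − Δ^{(k)}(□₀)↾` with
`ω = dist(·, □₀^{(k)}∖□^{(k)})`, (5.6) for both operators is `covOp_hyp56` [`B4BoxCov237`], and the Sect. 5
Theorem (5.10) is `B4Sect5Torus.perturb_bound`.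
[cite: Balaban1983RegularityDecay, p.574 (1.19)–(1.20); p.594 (5.5)–(5.10)] -/
theorem cov120_twoBox_sub_delta (d ℓ : ℕ) (hℓ : 1 ≤ ℓ) (aminus aplus m2plus a2minus a2plus : ℝ)
    (ha : 0 < aminus) (ha2 : 0 < a2minus) :
    ∃ δ c : ℝ, 0 < δ ∧ 0 < c ∧ ∀ (n : ℕ), 1 ≤ n → ∀ (a₁ m2 a₂ : ℝ), aminus ≤ a₁ → a₁ ≤ aplus → 0 ≤ m2 →
      m2 ≤ m2plus → a2minus ≤ a₂ → a₂ ≤ a2plus →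
      ∀ (M' M0' : Fin (d + 1) → ℕ), (∀ i, 1 ≤ M' i) → ∀ (s' : Fin (d + 1) → ℤ) (hs' : Fits M' M0' s'),
        ∀ {m : Type*} [Fintype m] [DecidableEq m] (e : m → ↥(boxDom (fun i => (ℓ + 1) * M' i))),
          Function.Injective e → ∀ i i' : m,
            |(covOpSub n ℓ a₁ a₂ m2 M' e)⁻¹ i i'
                - (covOpSub n ℓ a₁ a₂ m2 M0' (emb (hs'.scale (ℓ + 1)) ∘ e))⁻¹ i i'|
              ≤ c * Real.exp (-(δ * (supNorm ((e i).1 - (e i').1)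
                  + distOut (hs'.scale (ℓ + 1)) (e i) + distOut (hs'.scale (ℓ + 1)) (e i')))) := by
  obtain ⟨γ₀, c₀, κ, hγ, hc, hκ, -, hA⟩ := covOp_hyp56 d ℓ hℓ aminus aplus m2plus a2minus a2plus ha ha2
  obtain ⟨δK, cK, hδK, hcK, hB⟩ := keff55_twoBox d aminus aplus m2plus ha
  have hKn : ∀ a : ℝ, 0 < a → 0 ≤ latticeConst (d + 1) a := fun a ha => latticeConst_nonneg (d + 1) ha.le
  set δ₀ := min κ δK with hδ₀
  have hδ₀pos : 0 < δ₀ := lt_min hκ hδK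
  set c₁ := c₀ + cK + 1 with hc₁
  have hc₁pos : 0 < c₁ := by positivity
  have hBC := bigC_nonneg hKn hγ hc₁pos.le hδ₀pos (K := latticeConst (d + 1))
  refine ⟨rate (latticeConst (d + 1)) γ₀ c₁ δ₀ / 4, bigC (latticeConst (d + 1)) γ₀ c₁ δ₀ + 1,
    by have := rate_pos hKn hγ hc₁pos.le hδ₀pos; positivity, by positivity, ?_⟩
  intro n hn a₁ m2 a₂ h1 h2 h3 h4 h5 h6 M' M0' hM' s' hs' m _ _ e he i i'
  have hM0' : ∀ i, 1 ≤ M0' i := hs'.one_le hM'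
  have hLM' : ∀ i, 1 ≤ (ℓ + 1) * M' i := fun i => le_trans (hM' i) (Nat.le_mul_of_pos_left _ (by omega))
  -- the two operators `A = (Δ^{(k)}(□₀) + aL⁻²P)↾_{□^{(k)}}` and `A + B = Δ^{(k)}(□) + aL⁻²P`
  set ιu := emb (hs'.scale (ℓ + 1)) with hιu
  set A := (covOp n ℓ a₁ a₂ m2 M0').submatrix ιu ιu with hAdef
  set B := Keff n a₁ m2 (fun i => (ℓ + 1) * M' i)
    - (Keff n a₁ m2 (fun i => (ℓ + 1) * M0' i)).submatrix ιu ιu with hBdef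
  have hAB : A + B = covOp n ℓ a₁ a₂ m2 M' := by
    rw [hAdef, hBdef, hιu, covOp_submatrix n ℓ a₁ a₂ m2 hs', covOp]
    abel
  -- (5.6) for both, with the common constants `γ₀, c₁, δ₀`
  have hρnn : ∀ p q : ↥(boxDom (fun i => (ℓ + 1) * M' i)), 0 ≤ rho _ p q :=
    fun p q => (rho_isPseudoDist _).nonneg p q
  have h56A : Hyp56 (rho (fun i => (ℓ + 1) * M' i)) A γ₀ c₁ δ₀ := by
    have h0 := hyp56_submatrix (hA n hn a₁ m2 a₂ h1 h2 h3 h4 h5 h6 M0' hM0') (emb_injective (hs'.scale (ℓ + 1)))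
    rw [rho_emb] at h0
    exact hyp56_weaken hρnn h0 hc (by rw [hc₁]; linarith) (min_le_left _ _)
  have h56AB : Hyp56 (rho (fun i => (ℓ + 1) * M' i)) (A + B) γ₀ c₁ δ₀ := by
    rw [hAB]
    exact hyp56_weaken hρnn (hA n hn a₁ m2 a₂ h1 h2 h3 h4 h5 h6 M' hM') hc (by rw [hc₁]; linarith)
      (min_le_left _ _)
  -- (5.9) for `B` with `ω = dist(·, □₀^{(k)} ∖ □^{(k)})`: this is (5.5)
  have h59 : Hyp59 (rho (fun i => (ℓ + 1) * M' i)) (distOut (hs'.scale (ℓ + 1))) B c₁ δ₀ := by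
    intro p q
    have hb := hB n hn a₁ m2 h1 h2 h3 h4 (fun i => (ℓ + 1) * M' i) (fun i => (ℓ + 1) * M0' i) hLM'
      (fun i => ((ℓ + 1 : ℕ) : ℤ) * s' i) (hs'.scale (ℓ + 1)) p q
    have hBpq : B p q = Keff n a₁ m2 (fun i => (ℓ + 1) * M' i) p q
        - Keff n a₁ m2 (fun i => (ℓ + 1) * M0' i) (ιu p) (ιu q) := by
      rw [hBdef, Matrix.sub_apply, Matrix.submatrix_apply]
    rw [hBpq]
    refine hb.trans ?_
    have hT : 0 ≤ rho (fun i => (ℓ + 1) * M' i) p q + distOut (hs'.scale (ℓ + 1)) p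
        + distOut (hs'.scale (ℓ + 1)) q := by
      have := distOut_nonneg (hs'.scale (ℓ + 1)) p
      have := distOut_nonneg (hs'.scale (ℓ + 1)) q
      have := hρnn p q
      positivity
    have e1 : Real.exp (-(δK * (rho (fun i => (ℓ + 1) * M' i) p q + distOut (hs'.scale (ℓ + 1)) p
        + distOut (hs'.scale (ℓ + 1)) q)))
        ≤ Real.exp (-(δ₀ * (rho (fun i => (ℓ + 1) * M' i) p q + distOut (hs'.scale (ℓ + 1)) p
          + distOut (hs'.scale (ℓ + 1)) q))) :=
      Real.exp_le_exp.2 (by nlinarith [min_le_right κ δK])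
    calc cK * Real.exp (-(δK * (rho (fun i => (ℓ + 1) * M' i) p q + distOut (hs'.scale (ℓ + 1)) p
          + distOut (hs'.scale (ℓ + 1)) q)))
        ≤ cK * Real.exp (-(δ₀ * (rho (fun i => (ℓ + 1) * M' i) p q + distOut (hs'.scale (ℓ + 1)) p
          + distOut (hs'.scale (ℓ + 1)) q))) := mul_le_mul_of_nonneg_left e1 hcK.le
      _ ≤ c₁ * Real.exp (-(δ₀ * (rho (fun i => (ℓ + 1) * M' i) p q + distOut (hs'.scale (ℓ + 1)) p
          + distOut (hs'.scale (ℓ + 1)) q))) :=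
          mul_le_mul_of_nonneg_right (by rw [hc₁]; linarith) (Real.exp_pos _).le
  -- the Sect. 5 Theorem (5.10)
  have h := perturb_bound hKn hγ hc₁pos hδ₀pos (rho_isPseudoDist _) (rho_sumBound _) h56A h56AB
    (distOut_nonneg (hs'.scale (ℓ + 1))) (distOut_le_rho_add (hs'.scale (ℓ + 1))) h59 he i i'
  have hsubA : A.submatrix e e = covOpSub n ℓ a₁ a₂ m2 M0' (ιu ∘ e) := by
    rw [hAdef, Matrix.submatrix_submatrix]; rfl
  have hsubAB : (A + B).submatrix e e = covOpSub n ℓ a₁ a₂ m2 M' e := by rw [hAB]; rfl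
  rw [hsubA, hsubAB, abs_sub_comm] at h
  refine h.trans ?_
  exact mul_le_mul_of_nonneg_right (le_add_of_nonneg_right zero_le_one) (Real.exp_pos _).le

/-- **(1.20) with `Λ = □^{(k)}` (no restriction): the full unit-lattice propagators of the two boxes compared
on the inner box**, `|C^{(k)}(□; y, y′) − C_{□^{(k)}}^{(k)}(□₀; y+Ls′, y′+Ls′)| ≤ c e^{−δ(|y−y′| + ω(y) + ω(y′))}`.
[cite: Balaban1983RegularityDecay, p.574 (1.19)–(1.20)] -/
theorem cov120_twoBox_delta (d ℓ : ℕ) (hℓ : 1 ≤ ℓ) (aminus aplus m2plus a2minus a2plus : ℝ)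
    (ha : 0 < aminus) (ha2 : 0 < a2minus) :
    ∃ δ c : ℝ, 0 < δ ∧ 0 < c ∧ ∀ (n : ℕ), 1 ≤ n → ∀ (a₁ m2 a₂ : ℝ), aminus ≤ a₁ → a₁ ≤ aplus → 0 ≤ m2 →
      m2 ≤ m2plus → a2minus ≤ a₂ → a₂ ≤ a2plus →
      ∀ (M' M0' : Fin (d + 1) → ℕ), (∀ i, 1 ≤ M' i) → ∀ (s' : Fin (d + 1) → ℤ) (hs' : Fits M' M0' s'),
        ∀ y y' : ↥(boxDom (fun i => (ℓ + 1) * M' i)),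
          |(covOp n ℓ a₁ a₂ m2 M')⁻¹ y y'
              - (covOpSub n ℓ a₁ a₂ m2 M0' (emb (hs'.scale (ℓ + 1))))⁻¹ y y'|
            ≤ c * Real.exp (-(δ * (supNorm (y.1 - y'.1)
                + distOut (hs'.scale (ℓ + 1)) y + distOut (hs'.scale (ℓ + 1)) y'))) := by
  obtain ⟨δ, c, hδ, hc, h⟩ := cov120_twoBox_sub_delta d ℓ hℓ aminus aplus m2plus a2minus a2plus ha ha2
  refine ⟨δ, c, hδ, hc, ?_⟩
  intro n hn a₁ m2 a₂ h1 h2 h3 h4 h5 h6 M' M0' hM' s' hs' y y'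
  have h' := h n hn a₁ m2 a₂ h1 h2 h3 h4 h5 h6 M' M0' hM' s' hs' id Function.injective_id y y'
  have hid : covOpSub n ℓ a₁ a₂ m2 M' id = covOp n ℓ a₁ a₂ m2 M' := by
    unfold covOpSub; exact Matrix.submatrix_id_id _
  rw [hid] at h'
  exact h'

/-- **(1.20) for a `Finset` `Λ ⊆ □^{(k)}` of inner unit sites.**
[cite: Balaban1983RegularityDecay, p.574 (1.19)–(1.20)] -/
theorem cov120_twoBox_finset_delta (d ℓ : ℕ) (hℓ : 1 ≤ ℓ) (aminus aplus m2plus a2minus a2plus : ℝ)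
    (ha : 0 < aminus) (ha2 : 0 < a2minus) :
    ∃ δ c : ℝ, 0 < δ ∧ 0 < c ∧ ∀ (n : ℕ), 1 ≤ n → ∀ (a₁ m2 a₂ : ℝ), aminus ≤ a₁ → a₁ ≤ aplus → 0 ≤ m2 →
      m2 ≤ m2plus → a2minus ≤ a₂ → a₂ ≤ a2plus →
      ∀ (M' M0' : Fin (d + 1) → ℕ), (∀ i, 1 ≤ M' i) → ∀ (s' : Fin (d + 1) → ℤ) (hs' : Fits M' M0' s'),
        ∀ Λ : Finset ↥(boxDom (fun i => (ℓ + 1) * M' i)), ∀ y y' : ↥Λ,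
          |(covOpSub n ℓ a₁ a₂ m2 M' (fun y : ↥Λ => y.1))⁻¹ y y'
              - (covOpSub n ℓ a₁ a₂ m2 M0' (fun y : ↥Λ => emb (hs'.scale (ℓ + 1)) y.1))⁻¹ y y'|
            ≤ c * Real.exp (-(δ * (supNorm (y.1.1 - y'.1.1)
                + distOut (hs'.scale (ℓ + 1)) y.1 + distOut (hs'.scale (ℓ + 1)) y'.1))) := by
  obtain ⟨δ, c, hδ, hc, h⟩ := cov120_twoBox_sub_delta d ℓ hℓ aminus aplus m2plus a2minus a2plus ha ha2
  refine ⟨δ, c, hδ, hc, ?_⟩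
  intro n hn a₁ m2 a₂ h1 h2 h3 h4 h5 h6 M' M0' hM' s' hs' Λ y y'
  exact h n hn a₁ m2 a₂ h1 h2 h3 h4 h5 h6 M' M0' hM' s' hs' (fun y : ↥Λ => y.1) Subtype.val_injective y y'

/-- non-vacuity at `d + 1 = 4`, `L = 2`, window `a_k ∈ [1/2, 2]`, `m_k² ∈ [0, 1]`, `a ∈ [1/2, 2]`: (1.20) for every
nested pair of boxes and every `Finset` `Λ` of inner unit sites. -/
example : ∃ δ c : ℝ, 0 < δ ∧ 0 < c ∧ ∀ (n : ℕ), 1 ≤ n → ∀ (a₁ m2 a₂ : ℝ), (1 / 2 : ℝ) ≤ a₁ → a₁ ≤ 2 → 0 ≤ m2 →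
    m2 ≤ 1 → (1 / 2 : ℝ) ≤ a₂ → a₂ ≤ 2 →
    ∀ (M' M0' : Fin (3 + 1) → ℕ), (∀ i, 1 ≤ M' i) → ∀ (s' : Fin (3 + 1) → ℤ) (hs' : Fits M' M0' s'),
      ∀ Λ : Finset ↥(boxDom (fun i => (1 + 1) * M' i)), ∀ y y' : ↥Λ,
        |(covOpSub n 1 a₁ a₂ m2 M' (fun y : ↥Λ => y.1))⁻¹ y y'
            - (covOpSub n 1 a₁ a₂ m2 M0' (fun y : ↥Λ => emb (hs'.scale (1 + 1)) y.1))⁻¹ y y'|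
          ≤ c * Real.exp (-(δ * (supNorm (y.1.1 - y'.1.1)
              + distOut (hs'.scale (1 + 1)) y.1 + distOut (hs'.scale (1 + 1)) y'.1))) :=
  cov120_twoBox_finset_delta 3 1 le_rfl (1 / 2) 2 1 (1 / 2) 2 (by norm_num) (by norm_num)

end

end Literature.MathematicalPhysics.QuantumFieldTheory.Balaban1983to89.B4TwoBox120
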